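import Literature.Computability.MetaComplexity.EFAssemblyRef
import HarnessLib

/-!
# Assembly of the RSA-pair tautologies, VI: allocation, variables, sizes, and the theorem

The last layer of the assembly: the extension list `E` of the refutation is well allocated above
the variables of `T₀, T₁` (`RSA.isExtList_E`), the variables of `T₀` and `T₁` meet only in the
atoms (`RSA.vars_inter`), the refutation becomes an `EF`-proof of `¬⋀T₀ ∨ ¬⋀T₁` by the scaffold
(`EFScaffold.lean`) and is moved to an arbitrary Frege system by the Cook–Reckhow translation;
with the covering property (`EFAssemblySem.lean`) this proves
`Literature.Barriers.PneNP.RSAPairDisjointnessEFProofs` from any *kit family*: operation kits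
computing modular multiplication at every bit length, of polynomial size (`RSA.KitFamily`,
`RSA.rsaPairDisjointnessEFProofs_of_kitFamily`).

## Sources

* J. Krajíček, P. Pudlák, *Some consequences of cryptographical conjectures for `S¹₂` and `EF`*,
  Inform. and Comput. 140 (1998), Thm. 1, Cor. 10.
* S. A. Cook, R. A. Reckhow, *The relative efficiency of propositional proof systems*,
  J. Symbolic Logic 44 (1979), §2, Def. 4.1, Thm. 4.5.
-/

namespace Literature.Computability.MetaComplexity

open _root_.Computability Complexity Complexity.PropForm FregeSystem Netlist ModAdd

namespace RSA

variable {W : ℕ} {k : ModAdd.OpKit W} {m P₀ P₁ Eb : ℕ}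

/-! ### Extension lists of families -/

/-- **A family of well-allocated lists with increasing starts is well allocated.** [folklore] -/
theorem isExtList_flatMap {f : ℕ → List (ℕ × PropForm ℕ)} {st : ℕ → ℕ} (hmono : ∀ i, st i ≤ st (i + 1)) :
    ∀ N, (∀ i < N, FregeSystem.IsExtList (st i) (f i)) → (∀ i < N, ∀ e ∈ f i, e.1 < st (i + 1)) →
      FregeSystem.IsExtList (st 0) ((List.range N).flatMap f) ∧ ∀ e ∈ (List.range N).flatMap f, e.1 < st N
  | 0, _, _ => ⟨by simpa using FregeSystem.IsExtList.nil (st 0), by simp⟩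
  | N + 1, h, hlt => by
    obtain ⟨ih1, ih2⟩ := isExtList_flatMap hmono N (fun i hi => h i (by omega)) fun i hi => hlt i (by omega)
    have hst : st 0 ≤ st N := by
      have : ∀ n, st 0 ≤ st n := fun n => Nat.rec le_rfl (fun n ih => ih.trans (hmono n)) n
      exact this N
    rw [List.range_succ, List.flatMap_append, List.flatMap_singleton]
    refine ⟨ih1.append (h N (by omega)) hst ih2, fun e he => ?_⟩
    rcases List.mem_append.1 he with he | he
    · exact (ih2 e he).trans_le (hmono N)
    · exact hlt N (by omega) e he

/-! ### Bounds on the variables of chain occurrences -/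

/-- An upper bound for all node and gate variables of a chain occurrence. [folklore] -/
def hiC (k : ModAdd.OpKit W) (o : Occ) : ℕ := o.base + k.chainT.length + 2 * k.T.length

/-- Offsets of the pieces `S_j` are monotone. [folklore] -/
theorem offS_mono {j j' : ℕ} (h : j ≤ j') : k.offS j ≤ k.offS j' := by unfold OpKit.offS; nlinarith [Nat.zero_le k.B]

/-- The offsets of `S_j` (`j ≤ W`) plus one operation fit below the chain length plus one operation. [folklore] -/
theorem offS_le {j : ℕ} (hj : j ≤ W) : k.offS j + 2 * k.T.length ≤ k.chainT.length + 2 * k.T.length := by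
  have := offS_mono (k := k) hj; rw [k.length_chainT]; omega

/-- **Node variables are below `hiC`.** [folklore] -/
theorem nodes_lt {o : Occ} (ho : ∀ q < 3 * W, o.inp q < o.base) {j i : ℕ} (hj : j ≤ W) (hi : i < W) :
    k.s o j i < hiC k o ∧ k.t o j i < hiC k o ∧ k.p o j i < hiC k o := by
  have hoff := offS_le (k := k) hj
  refine ⟨?_, ?_, ?_⟩
  · cases j with
    | zero => have := ho i (by omega); simp only [OpKit.s, hiC]; omega
    | succ j =>
      have := k.resOff_lt i hi; have := offS_le (k := k) (show j ≤ W by omega)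
      simp only [OpKit.s, hiC]; omega
  · have := k.tOff_lt hj hi; rw [k.t_eq]; simp only [hiC]; omega
  · have := k.resOff_lt i hi; simp only [OpKit.p, OpKit.res, OpKit.Po, hiC]; omega

/-- Inputs of `S_j`, `P_j` are below `hiC`. [folklore] -/
theorem SoPo_inp_lt {o : Occ} (ho : ∀ q < 3 * W, o.inp q < o.base) {j : ℕ} (hj : j ≤ W) {q : ℕ} (hq : q < 3 * W) :
    (k.So o j).inp q < hiC k o ∧ (k.Po o j).inp q < hiC k o := by
  have h0 : o.base ≤ hiC k o := by simp only [hiC]; omega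
  refine ⟨?_, ?_⟩
  · simp only [OpKit.So]; split_ifs with h1 h2
    · exact (nodes_lt ho hj h1).1
    · exact (nodes_lt ho hj (show q - W < W by omega)).1
    · exact (ho q hq).trans_le h0
  · simp only [OpKit.Po]; split_ifs with h1 h2
    · exact (nodes_lt ho hj h1).2.1
    · exact (nodes_lt ho hj (show q - W < W by omega)).1
    · exact (ho q hq).trans_le h0

/-- Gates of `S_j`, `P_j` are below `hiC`. [folklore] -/
theorem SoPo_gate_lt {o : Occ} {j : ℕ} (hj : j ≤ W) {g : ℕ} (hg : g < k.T.length) :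
    (k.So o j).base + g < hiC k o ∧ (k.Po o j).base + g < hiC k o := by
  have := offS_le (k := k) hj
  simp only [OpKit.So, OpKit.Po, hiC]; omega

/-- Values of in-range sources over a family of occurrences below a bound. [folklore] -/
theorem srcVal_lt {N nIn L X : ℕ} {os : ℕ → Occ} {sr : Src} (hok : sr.OK N nIn L) (hinp : ∀ r < N, ∀ q < nIn, (os r).inp q < X)
    (hgate : ∀ r < N, ∀ g < L, (os r).base + g < X) : sr.val os < X := by
  cases sr with
  | inp r i => exact hinp r hok.1 i hok.2
  | gate r g => exact hgate r hok.1 g hok.2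

/-- Inputs of a three-operand occurrence below a bound. [folklore] -/
theorem inp3_lt {x y n : ℕ → ℕ} {X : ℕ} (hx : ∀ i < W, x i < X) (hy : ∀ i < W, y i < X) (hn : ∀ i < W, n i < X) {q : ℕ} (hq : q < 3 * W) :
    inp3 (W := W) x y n q < X := by
  unfold inp3; split_ifs with h1 h2
  · exact hx q h1
  · exact hy _ (by omega)
  · exact hn _ (by omega)

/-- Inputs of a two-operand occurrence below a bound. [folklore] -/
theorem inp2_lt {x n : ℕ → ℕ} {X : ℕ} (hx : ∀ i < W, x i < X) (hn : ∀ i < W, n i < X) {q : ℕ} (hq : q < 2 * W) : inp2 (W := W) x n q < X := by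
  unfold inp2; split_ifs with h1
  · exact hx q h1
  · exact hn _ (by omega)

/-- The node `s_j` for `j ≤ W + 1` is below `hiC`. [folklore] -/
theorem s_lt {o : Occ} (ho : ∀ q < 3 * W, o.inp q < o.base) {j i : ℕ} (hj : j ≤ W + 1) (hi : i < W) : k.s o j i < hiC k o := by
  cases j with
  | zero => have := ho i (by omega); simp only [OpKit.s, hiC]; omega
  | succ j =>
    have := k.resOff_lt i hi; have := offS_le (k := k) (show j ≤ W by omega)
    simp only [OpKit.s, hiC]; omega

/-- Twice the operation template fits in the chain (`W > 0`). [folklore] -/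
theorem two_T_le (hW : 0 < W) : 2 * k.T.length ≤ k.chainT.length := by
  rw [k.length_chainT]; unfold OpKit.offS OpKit.B
  have : 1 * (2 * k.T.length + W) ≤ W * (2 * k.T.length + W) := Nat.mul_le_mul_right _ hW
  omega

/-! ### Bounds on the variables of the copies -/

section TBounds

variable (k m) {P : ℕ} (hP : 3 * m ≤ P)
include hP

/-- The words of a copy are below `P + m + 1`. [folklore] -/
theorem words_lt (i : ℕ) : nw m P i < P + m + 1 ∧ ew m P i < P + m + 1 ∧ yw m P i < P + m + 1 ∧ uw m P i < P + m + 1 ∧ onew m P i < bY m P := by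
  unfold nw ew yw uw onew zv ov bY; refine ⟨?_, ?_, ?_, ?_, ?_⟩ <;> split_ifs <;> omega

omit hP in
/-- The chain bounds of `A` and `Z` are below the end of the block (`W > 0`). [folklore] -/
theorem hiC_le (hW : 0 < W) : hiC k (Ao k m P) ≤ bEnd k m P ∧ hiC k (Zo k m P) ≤ bEnd k m P ∧ hiC k (Xo k m P) ≤ bEnd k m P + 2 * k.T.length := by
  have := two_T_le (k := k) hW
  simp only [hiC, Ao, Zo, Xo, bEnd, bC, bX, bZ]; omega

/-- Inputs of `Y`, `A`, `Z`, `X` are below their bases. [folklore] -/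
theorem inps_lt : (∀ q < 3 * W, (Yo (W := W) m P).inp q < (Yo (W := W) m P).base) ∧ (∀ q < 3 * W, (Ao k m P).inp q < (Ao k m P).base) ∧
    (∀ q < 3 * W, (Zo k m P).inp q < (Zo k m P).base) ∧ (∀ q < 3 * W, (Xo k m P).inp q < (Xo k m P).base) := by
  have hw := words_lt m hP
  refine ⟨fun q hq => inp3_lt (fun i _ => (hw i).2.2.2.2) (fun i _ => ?_) (fun i _ => ?_) hq, fun q hq => inp3_lt (fun i hi => ?_) (fun i _ => ?_) (fun i _ => ?_) hq,
    fun q hq => inp3_lt (fun i hi => ?_) (fun i _ => ?_) (fun i _ => ?_) hq, fun q hq => inp3_lt (fun i hi => ?_) (fun i _ => ?_) (fun i _ => ?_) hq⟩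
  · have := (hw i).2.2.1; show _ < bY m P; unfold bY; omega
  · have := (hw i).1; show _ < bY m P; unfold bY; omega
  · have := k.resOff_lt i hi; show bY m P + k.resOff i < bA k m P; unfold bA; omega
  · have := (hw i).2.1; show _ < bA k m P; unfold bA bY; omega
  · have := (hw i).1; show _ < bA k m P; unfold bA bY; omega
  · have := k.tOff_lt (le_refl W) hi; rw [k.t_eq]; show bA k m P + _ < bZ k m P; unfold bZ; omega
  · have := (hw i).2.2.2.1; show _ < bZ k m P; unfold bZ bA bY; omega
  · have := (hw i).1; show _ < bZ k m P; unfold bZ bA bY; omega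
  · have := k.resOff_lt i hi; show bY m P + k.resOff i < bX k m P; unfold bX bZ bA; omega
  · have := (hw i).2.2.2.1; show _ < bX k m P; unfold bX bZ bA bY; omega
  · have := (hw i).1; show _ < bX k m P; unfold bX bZ bA bY; omega

end TBounds

/-! ### The extension list is well allocated -/

section Alloc

/-- Basic consequences of the allocation hypotheses. [folklore] -/
theorem alloc_facts (hW : 0 < W) (hP0 : 3 * m ≤ P₀) (hP1 : 3 * m ≤ P₁) (h01 : bEnd k m P₀ ≤ P₁) (hEb : bEnd k m P₁ ≤ Eb) : hiC k (A1 k m P₁) ≤ Eb ∧ hiC k (Z1 k m P₁) ≤ Eb ∧ (∀ i, uw m P₀ i < Eb) ∧ (∀ i, uw m P₁ i < Eb) ∧ (∀ i, nw1 m P₁ i < Eb) ∧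
    (∀ i < W, k.res (Yo (W := W) m P₁) i < Eb) ∧ 2 * k.T.length ≤ k.chainT.length := by
  obtain ⟨hA, hZ, -⟩ := hiC_le k m (P := P₁) hW
  have hw0 := words_lt m hP0; have hw1 := words_lt m hP1
  have hb0 : P₀ + m + 1 ≤ bEnd k m P₀ := by simp only [bEnd, bC, bX, bZ, bA, bY]; omega
  have hb1 : P₁ + m + 1 ≤ bEnd k m P₁ := by simp only [bEnd, bC, bX, bZ, bA, bY]; omega
  refine ⟨hA.trans hEb, hZ.trans hEb, fun i => ?_, fun i => ?_, fun i => ?_, fun i hi => ?_, two_T_le hW⟩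
  · have := (hw0 i).2.2.2.1; omega
  · have := (hw1 i).2.2.2.1; omega
  · have := (hw1 i).1; simp only [nw1]; omega
  · have := k.resOff_lt i hi; show bY m P₁ + k.resOff i < Eb; simp only [bEnd, bC, bX, bZ, bA] at hEb; omega

/-- **A domain-support cell is well allocated.** [folklore] -/
theorem isExtList_domCell {b : ℕ} {o : Occ} (hhi : hiC k o ≤ b) (ho : ∀ q < 3 * W, o.inp q < o.base) {j' : ℕ} (hj' : j' ≤ W) :
    FregeSystem.IsExtList (b + j' * c1 k) (domCell k b o j') ∧ ∀ e ∈ domCell k b o j', e.1 < b + (j' + 1) * c1 k := by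
  have hS : ∀ q < k.domA.nIn, (domS k b o j').inp q < b + j' * c1 k := fun q hq =>
    (srcVal_lt (os := fun _ => k.So o j') (k.domA_ok q hq) (fun r _ q' hq' => (SoPo_inp_lt ho hj' hq').1) fun r _ g hg => (SoPo_gate_lt hj' hg).1).trans_le
      (hhi.trans (Nat.le_add_right _ _))
  have hP : ∀ q < k.domA.nIn, (domP k b o j').inp q < b + j' * c1 k + k.domA.T.length := fun q hq =>
    (srcVal_lt (os := fun _ => k.Po o j') (k.domA_ok q hq) (fun r _ q' hq' => (SoPo_inp_lt ho hj' hq').2) fun r _ g hg => (SoPo_gate_lt hj' hg).2).trans_le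
      (hhi.trans (by omega))
  have hD : ∀ q < 2 * W, (domD k b o j').inp q < b + j' * c1 k + 2 * k.domA.T.length := fun q hq =>
    (inp2_lt (X := hiC k o) (fun i hi => (nodes_lt ho hj' hi).2.1) (fun i hi => (ho (2 * W + i) (by omega)).trans_le (by simp only [hiC]; omega)) hq).trans_le
      (hhi.trans (by omega))
  have e1 := (domS k b o j').isExtList_edefs k.domA_wf hS le_rfl
  have e2 := (domP k b o j').isExtList_edefs k.domA_wf hP le_rfl
  have e3 := (domD k b o j').isExtList_edefs (Sub.wf_subT W) hD le_rfl
  have r1 := fun e (he : e ∈ (domS k b o j').edefs k.domA.T k.domA.nIn) => Occ.fst_mem_edefs he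
  have r2 := fun e (he : e ∈ (domP k b o j').edefs k.domA.T k.domA.nIn) => Occ.fst_mem_edefs he
  have r3 := fun e (he : e ∈ (domD k b o j').edefs (Sub.subT W) (2 * W)) => Occ.fst_mem_edefs he
  simp only [domS, domP, domD, Sub.length_subT] at r1 r2 r3 e1 e2 e3
  have hc1 : (j' + 1) * c1 k = j' * c1 k + (2 * k.domA.T.length + (3 * W + 1)) := by simp only [c1]; ring
  refine ⟨(e1.append e2 (by omega) fun e he => (r1 e he).2.trans_le (by omega)).append e3 (by omega) fun e he => ?_, fun e he => ?_⟩
  · rcases List.mem_append.1 he with he | he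
    · exact (r1 e he).2.trans_le (by omega)
    · exact (r2 e he).2.trans_le (by omega)
  · simp only [domCell, List.mem_append] at he
    rcases he with (he | he) | he
    · have := (r1 e he).2; rw [hc1]; omega
    · have := (r2 e he).2; rw [hc1]; omega
    · have := (r3 e he).2; rw [hc1]; omega

/-- Cells of a family stay below the family's end. [folklore] -/
theorem cell_le {c N s t : ℕ} (hc : c < N) (ht : t ≤ s) : c * s + t ≤ N * s := by
  calc c * s + t ≤ c * s + s := by omega
    _ = (c + 1) * s := by ring
    _ ≤ N * s := Nat.mul_le_mul_right _ hc

/-- The cell index of a decomposed counter. [folklore] -/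
theorem ci_eq (c : ℕ) : ci (W := W) (c / (W + 1)) (c % (W + 1)) = c := by unfold ci; rw [Nat.mul_comm]; exact Nat.div_add_mod c (W + 1)

/-- The cell index is below the number of cells. [folklore] -/
theorem ci_lt {j j' : ℕ} (hj : j ≤ W) (hj' : j' ≤ W) : ci (W := W) j j' < (W + 1) * (W + 1) := (ci_div_mod (W := W) hj hj').1

/-- A three-operand operation occurrence whose inputs are below its base is well allocated, with its
variables in `[base, base + |T|)`. [folklore] -/
theorem occ3_ext {o : Occ} (h : ∀ q < 3 * W, o.inp q < o.base) :
    FregeSystem.IsExtList o.base (o.edefs k.T (3 * W)) ∧ ∀ e ∈ o.edefs k.T (3 * W), o.base ≤ e.1 ∧ e.1 < o.base + k.T.length :=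
  ⟨o.isExtList_edefs k.wf h le_rfl, fun _ he => Occ.fst_mem_edefs he⟩

/-- The same for chain occurrences. [folklore] -/
theorem occC_ext {o : Occ} (h : ∀ q < 3 * W, o.inp q < o.base) :
    FregeSystem.IsExtList o.base (o.edefs k.chainT (3 * W)) ∧ ∀ e ∈ o.edefs k.chainT (3 * W), o.base ≤ e.1 ∧ e.1 < o.base + k.chainT.length :=
  ⟨o.isExtList_edefs k.wf_chainT h le_rfl, fun _ he => Occ.fst_mem_edefs he⟩

/-- **The data of a family of distributivity instances is well allocated**, given that the chains
`B_j, C_j` (`j ≤ W`) lie below `b` with inputs below their bases, and `n` below `b`. [folklore] -/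
theorem isExtList_distDefs {b : ℕ} {B C : ℕ → Occ} (hB : ∀ j ≤ W, hiC k (B j) ≤ b ∧ ∀ q < 3 * W, (B j).inp q < (B j).base)
    (hC : ∀ j ≤ W, hiC k (C j) ≤ b ∧ ∀ q < 3 * W, (C j).inp q < (C j).base) (hn : ∀ i, nw1 m P₁ i < b) :
    FregeSystem.IsExtList b (distDefs k m P₁ b B C) ∧ ∀ e ∈ distDefs k m P₁ b B C, e.1 < Fce k b := by
  have hjj : ∀ c < (W + 1) * (W + 1), c / (W + 1) ≤ W ∧ c % (W + 1) ≤ W := fun c hc =>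
    ⟨Nat.lt_succ_iff.1 (Nat.div_lt_of_lt_mul (by linarith)), Nat.lt_succ_iff.1 (Nat.mod_lt _ (by omega))⟩
  have hbF : b ≤ Fae k b := Nat.le_add_right _ _
  have hFF : Fae k b ≤ Fbe k b := Nat.le_add_right _ _
  -- bases
  have bQ : ∀ j j', (Qo k m P₁ b B C j j').base = b + ci (W := W) j j' * (2 * k.T.length) := fun _ _ => rfl
  have bR : ∀ j j', (Ro k m P₁ b B C j j').base = b + ci (W := W) j j' * (2 * k.T.length) + k.T.length := fun _ _ => rfl
  have bQQ : ∀ j j', (QQo k m P₁ b B C j j').base = Fae k b + ci (W := W) j j' * (3 * k.T.length) := fun _ _ => rfl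
  have bPP : ∀ j j', (PPo k m P₁ b B C j j').base = Fae k b + ci (W := W) j j' * (3 * k.T.length) + k.T.length := fun _ _ => rfl
  have bPR : ∀ j j', (PRo k m P₁ b B C j j').base = Fae k b + ci (W := W) j j' * (3 * k.T.length) + 2 * k.T.length := fun _ _ => rfl
  have bM1 : ∀ j j', (M1o k m P₁ b B C j j').base = Fbe k b + ci (W := W) j j' * c6 k := fun _ _ => rfl
  have bM2 : ∀ j j', (M2o k m P₁ b B C j j').base = Fbe k b + ci (W := W) j j' * c6 k + k.medA.T.length := fun _ _ => rfl
  have bU : ∀ j j', (Uo k m P₁ b B C j j').base = Fbe k b + ci (W := W) j j' * c6 k + 2 * k.medA.T.length := fun _ _ => rfl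
  -- the cells stay inside their families
  have cQ : ∀ {j j'}, j ≤ W → j' ≤ W → ∀ g < 2 * k.T.length, b + ci (W := W) j j' * (2 * k.T.length) + g < Fae k b := fun {j j'} hj hj' g hg => by
    have := cell_le (ci_lt (W := W) hj hj') (t := g + 1) (s := 2 * k.T.length) (by omega); show _ < b + _; omega
  have cQ' : ∀ {j j'}, j ≤ W → j' ≤ W → ∀ g < k.T.length, b + ci (W := W) j (j' + 1) * (2 * k.T.length) + g < Fbe k b := fun {j j'} hj hj' g hg => by
    have h1 : ci (W := W) j (j' + 1) ≤ (W + 1) * (W + 1) := by have := ci_lt (W := W) hj hj'; unfold ci at this ⊢; omega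
    have h2 := Nat.mul_le_mul_right (2 * k.T.length) h1
    have h3 : 3 * k.T.length ≤ (W + 1) * (W + 1) * (3 * k.T.length) := Nat.le_mul_of_pos_left _ (by positivity)
    show _ < b + _ + _; omega
  have cQQ : ∀ {j j'}, j ≤ W → j' ≤ W → ∀ g < 3 * k.T.length, Fae k b + ci (W := W) j j' * (3 * k.T.length) + g < Fbe k b := fun {j j'} hj hj' g hg => by
    have := cell_le (ci_lt (W := W) hj hj') (t := g + 1) (s := 3 * k.T.length) (by omega); show _ < Fae k b + _; omega
  have cM : ∀ {j j'}, j ≤ W → j' ≤ W → ∀ g < c6 k, Fbe k b + ci (W := W) j j' * c6 k + g < Fce k b := fun {j j'} hj hj' g hg => by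
    have := cell_le (ci_lt (W := W) hj hj') (t := g + 1) (s := c6 k) (by omega); show _ < Fbe k b + _; omega
  -- bounds on the inputs
  have hQi : ∀ {j j'}, j ≤ W → j' ≤ W + 1 → ∀ q < 3 * W, (Qo k m P₁ b B C j j').inp q < b := fun {j j'} hj hj' q hq =>
    inp3_lt (fun i hi => (s_lt (hB j hj).2 hj' hi).trans_le (hB j hj).1) (fun i hi => (s_lt (hC j hj).2 hj' hi).trans_le (hC j hj).1) (fun i _ => hn i) hq
  have hRi : ∀ {j j'}, j ≤ W → j' ≤ W → ∀ q < 3 * W, (Ro k m P₁ b B C j j').inp q < b := fun {j j'} hj hj' q hq =>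
    inp3_lt (fun i hi => (nodes_lt (hB j hj).2 hj' hi).2.1.trans_le (hB j hj).1) (fun i hi => (nodes_lt (hC j hj).2 hj' hi).2.1.trans_le (hC j hj).1) (fun i _ => hn i) hq
  have hQQi : ∀ {j j'}, j ≤ W → j' ≤ W → ∀ q < 3 * W, (QQo k m P₁ b B C j j').inp q < Fae k b := fun {j j'} hj hj' q hq =>
    inp3_lt (fun i hi => cQ hj hj' _ (by have := k.resOff_lt i hi; omega)) (fun i hi => cQ hj hj' _ (by have := k.resOff_lt i hi; omega))
      (fun i _ => (hn i).trans_le hbF) hq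
  have hPPi : ∀ {j j'}, j ≤ W → j' ≤ W → ∀ q < 3 * W, (PPo k m P₁ b B C j j').inp q < Fae k b := fun {j j'} hj hj' q hq =>
    inp3_lt (fun i hi => by have := k.resOff_lt i hi; have := cQ hj hj' (k.T.length + k.resOff i) (by omega); show b + _ + k.T.length + k.resOff i < _; omega)
      (fun i hi => cQ hj hj' _ (by have := k.resOff_lt i hi; omega)) (fun i _ => (hn i).trans_le hbF) hq
  have hPRi : ∀ {j j'}, j ≤ W → j' ≤ W → ∀ q < 3 * W, (PRo k m P₁ b B C j j').inp q < b := fun {j j'} hj hj' q hq =>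
    inp3_lt (fun i hi => (nodes_lt (hB j hj).2 hj' hi).2.2.trans_le (hB j hj).1) (fun i hi => (nodes_lt (hC j hj).2 hj' hi).2.2.trans_le (hC j hj).1) (fun i _ => hn i) hq
  have hM1i : ∀ {j j'}, j ≤ W → j' ≤ W → ∀ q < k.medA.nIn, (M1o k m P₁ b B C j j').inp q < Fbe k b := by
    intro j j' hj hj' q hq
    refine srcVal_lt (k.medA_ok q hq) (fun r hr q' hq' => ?_) fun r hr g hg => ?_
    · simp only [OpKit.os1]; split_ifs
      · exact (hQi hj (by omega) q' hq').trans_le (hbF.trans hFF)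
      · exact (hQi hj (by omega) q' hq').trans_le (hbF.trans hFF)
      · exact (hQQi hj hj' q' hq').trans_le hFF
      · exact ((SoPo_inp_lt (hB j hj).2 hj' hq').1.trans_le (hB j hj).1).trans_le (hbF.trans hFF)
      · exact ((SoPo_inp_lt (hC j hj).2 hj' hq').1.trans_le (hC j hj).1).trans_le (hbF.trans hFF)
      · exact (hQi hj (by omega) q' hq').trans_le (hbF.trans hFF)
    · simp only [OpKit.os1]; split_ifs
      · exact (cQ hj hj' g (by omega)).trans_le hFF
      · exact (cQ hj hj' g (by omega)).trans_le hFF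
      · exact cQQ hj hj' g (by omega)
      · exact ((SoPo_gate_lt hj' hg).1.trans_le (hB j hj).1).trans_le (hbF.trans hFF)
      · exact ((SoPo_gate_lt hj' hg).1.trans_le (hC j hj).1).trans_le (hbF.trans hFF)
      · exact cQ' hj hj' g hg
  have hM2i : ∀ {j j'}, j ≤ W → j' ≤ W → ∀ q < k.medA.nIn, (M2o k m P₁ b B C j j').inp q < Fbe k b := by
    intro j j' hj hj' q hq
    refine srcVal_lt (k.medA_ok q hq) (fun r hr q' hq' => ?_) fun r hr g hg => ?_
    · simp only [OpKit.os2]; split_ifs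
      · exact (hRi hj hj' q' hq').trans_le (hbF.trans hFF)
      · exact (hQi hj (by omega) q' hq').trans_le (hbF.trans hFF)
      · exact (hPPi hj hj' q' hq').trans_le hFF
      · exact ((SoPo_inp_lt (hB j hj).2 hj' hq').2.trans_le (hB j hj).1).trans_le (hbF.trans hFF)
      · exact ((SoPo_inp_lt (hC j hj).2 hj' hq').2.trans_le (hC j hj).1).trans_le (hbF.trans hFF)
      · exact (hPRi hj hj' q' hq').trans_le (hbF.trans hFF)
    · simp only [OpKit.os2]; split_ifs
      · have := cQ hj hj' (k.T.length + g) (by omega); show b + _ + k.T.length + g < _; omega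
      · exact (cQ hj hj' g (by omega)).trans_le hFF
      · have := cQQ hj hj' (k.T.length + g) (by omega); show Fae k b + _ + k.T.length + g < _; omega
      · exact ((SoPo_gate_lt hj' hg).2.trans_le (hB j hj).1).trans_le (hbF.trans hFF)
      · exact ((SoPo_gate_lt hj' hg).2.trans_le (hC j hj).1).trans_le (hbF.trans hFF)
      · have := cQQ hj hj' (2 * k.T.length + g) (by omega); show Fae k b + _ + 2 * k.T.length + g < _; omega
  have hUi : ∀ {j j'}, j ≤ W → j' ≤ W → ∀ q < k.unitA.nIn, (Uo k m P₁ b B C j j').inp q < Fbe k b := by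
    intro j j' hj hj' q hq
    refine srcVal_lt (os := fun _ => Ro k m P₁ b B C j j') (k.unitA_ok q hq) (fun r _ q' hq' => (hRi hj hj' q' hq').trans_le (hbF.trans hFF)) fun r _ g hg => ?_
    have := cQ hj hj' (k.T.length + g) (by omega); show b + _ + k.T.length + g < _; omega
  -- the three families
  have mono2 : ∀ c, b + c * (2 * k.T.length) ≤ b + (c + 1) * (2 * k.T.length) := fun c => Nat.add_le_add_left (Nat.mul_le_mul_right _ (Nat.le_succ c)) _
  have mono3 : ∀ c, Fae k b + c * (3 * k.T.length) ≤ Fae k b + (c + 1) * (3 * k.T.length) := fun c => Nat.add_le_add_left (Nat.mul_le_mul_right _ (Nat.le_succ c)) _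
  have mono6 : ∀ c, Fbe k b + c * c6 k ≤ Fbe k b + (c + 1) * c6 k := fun c => Nat.add_le_add_left (Nat.mul_le_mul_right _ (Nat.le_succ c)) _
  have fa := isExtList_flatMap (st := fun c => b + c * (2 * k.T.length))
    (f := fun c => (Qo k m P₁ b B C (c / (W + 1)) (c % (W + 1))).edefs k.T (3 * W) ++ (Ro k m P₁ b B C (c / (W + 1)) (c % (W + 1))).edefs k.T (3 * W))
    mono2 ((W + 1) * (W + 1)) (fun c hc => ?_) (fun c hc e he => ?_)
  rotate_left
  · obtain ⟨hj, hj'⟩ := hjj c hc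
    obtain ⟨e1, r1⟩ := occ3_ext (k := k) (o := Qo k m P₁ b B C (c / (W + 1)) (c % (W + 1))) fun q hq => (hQi hj (by omega) q hq).trans_le (Nat.le_add_right _ _)
    obtain ⟨e2, r2⟩ := occ3_ext (k := k) (o := Ro k m P₁ b B C (c / (W + 1)) (c % (W + 1))) fun q hq => (hRi hj hj' q hq).trans_le (by rw [bR]; omega)
    simp only [bQ, bR, ci_eq] at e1 e2 r1 r2
    exact e1.append e2 (by omega) fun e he => (r1 e he).2.trans_le (by omega)
  · obtain ⟨hj, hj'⟩ := hjj c hc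
    show e.1 < b + (c + 1) * (2 * k.T.length)
    have e1 : (c + 1) * (2 * k.T.length) = c * (2 * k.T.length) + 2 * k.T.length := by ring
    rcases List.mem_append.1 he with he | he
    · have := (Occ.fst_mem_edefs he).2; simp only [bQ, ci_eq] at this; omega
    · have := (Occ.fst_mem_edefs he).2; simp only [bR, ci_eq] at this; omega
  have fb := isExtList_flatMap (st := fun c => Fae k b + c * (3 * k.T.length))
    (f := fun c => (QQo k m P₁ b B C (c / (W + 1)) (c % (W + 1))).edefs k.T (3 * W) ++ (PPo k m P₁ b B C (c / (W + 1)) (c % (W + 1))).edefs k.T (3 * W) ++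
      (PRo k m P₁ b B C (c / (W + 1)) (c % (W + 1))).edefs k.T (3 * W))
    mono3 ((W + 1) * (W + 1)) (fun c hc => ?_) (fun c hc e he => ?_)
  rotate_left
  · obtain ⟨hj, hj'⟩ := hjj c hc
    obtain ⟨e1, r1⟩ := occ3_ext (k := k) (o := QQo k m P₁ b B C (c / (W + 1)) (c % (W + 1))) fun q hq => (hQQi hj hj' q hq).trans_le (Nat.le_add_right _ _)
    obtain ⟨e2, r2⟩ := occ3_ext (k := k) (o := PPo k m P₁ b B C (c / (W + 1)) (c % (W + 1))) fun q hq => (hPPi hj hj' q hq).trans_le (by rw [bPP]; omega)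
    obtain ⟨e3, r3⟩ := occ3_ext (k := k) (o := PRo k m P₁ b B C (c / (W + 1)) (c % (W + 1))) fun q hq => (hPRi hj hj' q hq).trans_le (by rw [bPR]; omega)
    simp only [bQQ, bPP, bPR, ci_eq] at e1 e2 e3 r1 r2 r3
    exact (e1.append e2 (by omega) fun e he => (r1 e he).2.trans_le (by omega)).append e3 (by omega) fun e he => by
      rcases List.mem_append.1 he with he | he
      · exact (r1 e he).2.trans_le (by omega)
      · exact (r2 e he).2.trans_le (by omega)
  · obtain ⟨hj, hj'⟩ := hjj c hc
    show e.1 < Fae k b + (c + 1) * (3 * k.T.length)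
    have e1 : (c + 1) * (3 * k.T.length) = c * (3 * k.T.length) + 3 * k.T.length := by ring
    rcases List.mem_append.1 he with he | he
    · rcases List.mem_append.1 he with he | he
      · have := (Occ.fst_mem_edefs he).2; simp only [bQQ, ci_eq] at this; omega
      · have := (Occ.fst_mem_edefs he).2; simp only [bPP, ci_eq] at this; omega
    · have := (Occ.fst_mem_edefs he).2; simp only [bPR, ci_eq] at this; omega
  have fc := isExtList_flatMap (st := fun c => Fbe k b + c * c6 k)
    (f := fun c => (M1o k m P₁ b B C (c / (W + 1)) (c % (W + 1))).edefs k.medA.T k.medA.nIn ++ (M2o k m P₁ b B C (c / (W + 1)) (c % (W + 1))).edefs k.medA.T k.medA.nIn ++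
      (Uo k m P₁ b B C (c / (W + 1)) (c % (W + 1))).edefs k.unitA.T k.unitA.nIn)
    mono6 ((W + 1) * (W + 1)) (fun c hc => ?_) (fun c hc e he => ?_)
  rotate_left
  · obtain ⟨hj, hj'⟩ := hjj c hc
    have e1 := (M1o k m P₁ b B C (c / (W + 1)) (c % (W + 1))).isExtList_edefs k.medA_wf (fun q hq => (hM1i hj hj' q hq).trans_le (Nat.le_add_right _ _)) le_rfl
    have e2 := (M2o k m P₁ b B C (c / (W + 1)) (c % (W + 1))).isExtList_edefs k.medA_wf (fun q hq => (hM2i hj hj' q hq).trans_le (by rw [bM2]; omega)) le_rfl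
    have e3 := (Uo k m P₁ b B C (c / (W + 1)) (c % (W + 1))).isExtList_edefs k.unitA_wf (fun q hq => (hUi hj hj' q hq).trans_le (by rw [bU]; omega)) le_rfl
    have r1 := fun e (he : e ∈ (M1o k m P₁ b B C (c / (W + 1)) (c % (W + 1))).edefs k.medA.T k.medA.nIn) => Occ.fst_mem_edefs he
    have r2 := fun e (he : e ∈ (M2o k m P₁ b B C (c / (W + 1)) (c % (W + 1))).edefs k.medA.T k.medA.nIn) => Occ.fst_mem_edefs he
    simp only [bM1, bM2, bU, ci_eq] at e1 e2 e3 r1 r2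
    exact (e1.append e2 (by omega) fun e he => (r1 e he).2.trans_le (by omega)).append e3 (by omega) fun e he => by
      rcases List.mem_append.1 he with he | he
      · exact (r1 e he).2.trans_le (by omega)
      · exact (r2 e he).2.trans_le (by omega)
  · obtain ⟨hj, hj'⟩ := hjj c hc
    show e.1 < Fbe k b + (c + 1) * c6 k
    have e1 : (c + 1) * c6 k = c * c6 k + c6 k := by ring
    have e6 : c6 k = 2 * k.medA.T.length + k.unitA.T.length := rfl
    rcases List.mem_append.1 he with he | he
    · rcases List.mem_append.1 he with he | he
      · have := (Occ.fst_mem_edefs he).2; simp only [bM1, ci_eq] at this; omega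
      · have := (Occ.fst_mem_edefs he).2; simp only [bM2, ci_eq] at this; omega
    · have := (Occ.fst_mem_edefs he).2; simp only [bU, ci_eq] at this; omega
  -- assemble
  obtain ⟨fa1, fa2⟩ := fa; obtain ⟨fb1, fb2⟩ := fb; obtain ⟨fc1, fc2⟩ := fc
  simp only [Nat.zero_mul, Nat.add_zero] at fa1 fb1 fc1
  have eFae : Fae k b = b + (W + 1) * (W + 1) * (2 * k.T.length) := rfl
  have eFbe : Fbe k b = Fae k b + (W + 1) * (W + 1) * (3 * k.T.length) := rfl
  have eFce : Fce k b = Fbe k b + (W + 1) * (W + 1) * c6 k := rfl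
  refine ⟨(fa1.append fb1 hbF fun e he => by rw [eFae]; exact fa2 e he).append fc1 (hbF.trans hFF) fun e he => ?_, fun e he => ?_⟩
  · rcases List.mem_append.1 he with he | he
    · rw [eFbe, eFae]; exact (fa2 e he).trans_le (by omega)
    · rw [eFbe]; exact fb2 e he
  · unfold distDefs at he
    rcases List.mem_append.1 he with he | he
    · rcases List.mem_append.1 he with he | he
      · rw [eFce, eFbe, eFae]; exact (fa2 e he).trans_le (by omega)
      · rw [eFce, eFbe]; exact (fb2 e he).trans_le (by omega)
    · rw [eFce]; exact fc2 e he

/-- The allocation facts used by the families. [folklore] -/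
structure AllocFacts (k : ModAdd.OpKit W) (m P₀ P₁ Eb : ℕ) : Prop where
  /-- `A₁` below `Eb` -/
  hA1 : hiC k (A1 k m P₁) ≤ Eb
  /-- `Z₁` below `Eb` -/
  hZ1 : hiC k (Z1 k m P₁) ≤ Eb
  /-- `u₀` below `Eb` -/
  hu0 : ∀ i, uw m P₀ i < Eb
  /-- `u₁` below `Eb` -/
  hu1 : ∀ i, uw m P₁ i < Eb
  /-- `n` below `Eb` -/
  hn1 : ∀ i, nw1 m P₁ i < Eb
  /-- `res Y₁` below `Eb` -/
  hrY : ∀ i < W, k.res (Yo (W := W) m P₁) i < Eb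
  /-- two operations fit in a chain -/
  h2L : 2 * k.T.length ≤ k.chainT.length
  /-- inputs of `A₁` -/
  inA1 : ∀ q < 3 * W, (A1 k m P₁).inp q < (A1 k m P₁).base
  /-- inputs of `Z₁` -/
  inZ1 : ∀ q < 3 * W, (Z1 k m P₁).inp q < (Z1 k m P₁).base

/-- The allocation facts hold under the allocation hypotheses. [folklore] -/
theorem allocFacts (hW : 0 < W) (hP0 : 3 * m ≤ P₀) (hP1 : 3 * m ≤ P₁) (h01 : bEnd k m P₀ ≤ P₁) (hEb : bEnd k m P₁ ≤ Eb) : AllocFacts k m P₀ P₁ Eb := by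
  obtain ⟨hA1, hZ1, hu0, hu1, hn1, hrY, h2L⟩ := alloc_facts (k := k) hW hP0 hP1 h01 hEb
  obtain ⟨-, inA1, inZ1, -⟩ := inps_lt k m (P := P₁) hP1
  exact ⟨hA1, hZ1, hu0, hu1, hn1, hrY, h2L, inA1, inZ1⟩

variable (af : AllocFacts k m P₀ P₁ Eb)
include af

/-- Inputs and bounds of the chains `Hs_j, Ht_j, Hp_j`. [folklore] -/
theorem fam3_facts : (∀ j ≤ W, ∀ q < 3 * W, (Hs k m P₀ P₁ Eb j).inp q < Eb) ∧ (∀ j ≤ W, ∀ q < 3 * W, (Ht k m P₀ P₁ Eb j).inp q < Eb) ∧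
    (∀ j ≤ W, ∀ q < 3 * W, (Hp k m P₀ P₁ Eb j).inp q < Eb) ∧ (∀ j ≤ W, hiC k (Hs k m P₀ P₁ Eb j) ≤ F3e k Eb) ∧ (∀ j ≤ W, hiC k (Ht k m P₀ P₁ Eb j) ≤ F3e k Eb) ∧
    (∀ j ≤ W, ∀ q < 3 * W, (Hs k m P₀ P₁ Eb j).inp q < (Hs k m P₀ P₁ Eb j).base) ∧ (∀ j ≤ W, ∀ q < 3 * W, (Ht k m P₀ P₁ Eb j).inp q < (Ht k m P₀ P₁ Eb j).base) := by
  have h2L := af.h2L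
  have inHs : ∀ j ≤ W, ∀ q < 3 * W, (Hs k m P₀ P₁ Eb j).inp q < Eb := fun j hj q hq =>
    inp3_lt (fun i hi => (s_lt af.inZ1 (by omega) hi).trans_le af.hZ1) (fun i _ => af.hu0 i) (fun i _ => af.hn1 i) hq
  have inHt : ∀ j ≤ W, ∀ q < 3 * W, (Ht k m P₀ P₁ Eb j).inp q < Eb := fun j hj q hq =>
    inp3_lt (fun i hi => (nodes_lt af.inZ1 hj hi).2.1.trans_le af.hZ1) (fun i _ => af.hu0 i) (fun i _ => af.hn1 i) hq
  have inHp : ∀ j ≤ W, ∀ q < 3 * W, (Hp k m P₀ P₁ Eb j).inp q < Eb := fun j hj q hq =>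
    inp3_lt (fun i hi => (nodes_lt af.inZ1 hj hi).2.2.trans_le af.hZ1) (fun i _ => af.hu0 i) (fun i _ => af.hn1 i) hq
  have e1 : F1e k Eb = Eb + (W + 1) * c1 k := rfl
  have e2 : F2e k Eb = F1e k Eb + 4 * k.chainT.length := rfl
  have e3 : F3e k Eb = F2e k Eb + (3 * W + 3) * k.chainT.length := rfl
  refine ⟨inHs, inHt, inHp, fun j hj => ?_, fun j hj => ?_, fun j hj q hq => (inHs j hj q hq).trans_le ?_, fun j hj q hq => (inHt j hj q hq).trans_le ?_⟩
  · have := Nat.mul_le_mul_right k.chainT.length hj; simp only [hiC, Hs, e3]; nlinarith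
  · have := Nat.mul_le_mul_right k.chainT.length hj; simp only [hiC, Ht, e3]; nlinarith
  · simp only [Hs, e2, e1]; omega
  · simp only [Ht, e2, e1]; omega

/-- Family 1 is well allocated. [folklore] -/
theorem fam1 : FregeSystem.IsExtList Eb ((List.range (W + 1)).flatMap (domCell k Eb (A1 k m P₁))) ∧
    ∀ e ∈ (List.range (W + 1)).flatMap (domCell k Eb (A1 k m P₁)), e.1 < F1e k Eb := by
  have h := isExtList_flatMap (st := fun j' => Eb + j' * c1 k) (f := domCell k Eb (A1 k m P₁))
    (fun c => Nat.add_le_add_left (Nat.mul_le_mul_right _ (Nat.le_succ c)) _) (W + 1)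
    (fun j' hj' => (isExtList_domCell af.hA1 af.inA1 (by omega)).1) fun j' hj' e he => (isExtList_domCell af.hA1 af.inA1 (by omega)).2 e he
  simp only [Nat.zero_mul, Nat.add_zero] at h
  exact h

/-- Family 2 is well allocated. [folklore] -/
theorem fam2 : FregeSystem.IsExtList (F1e k Eb) ((B0 k m P₀ P₁ Eb).edefs k.chainT (3 * W) ++ (A4o k m P₀ P₁ Eb).edefs k.chainT (3 * W) ++
      (A2o k m P₀ P₁ Eb).edefs k.chainT (3 * W) ++ (Cc0 k m P₀ P₁ Eb).edefs k.chainT (3 * W)) ∧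
    ∀ e ∈ (B0 k m P₀ P₁ Eb).edefs k.chainT (3 * W) ++ (A4o k m P₀ P₁ Eb).edefs k.chainT (3 * W) ++ (A2o k m P₀ P₁ Eb).edefs k.chainT (3 * W) ++
      (Cc0 k m P₀ P₁ Eb).edefs k.chainT (3 * W), e.1 < F2e k Eb := by
  have l01 : Eb ≤ F1e k Eb := Nat.le_add_right _ _
  have eF2 : F2e k Eb = F1e k Eb + 4 * k.chainT.length := rfl
  obtain ⟨gB, rB⟩ := occC_ext (k := k) (o := B0 k m P₀ P₁ Eb) fun q hq =>
    (inp3_lt (fun i hi => (nodes_lt af.inA1 le_rfl hi).2.1.trans_le af.hA1) (fun i _ => af.hu0 i) (fun i _ => af.hn1 i) hq).trans_le l01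
  obtain ⟨gA4, rA4⟩ := occC_ext (k := k) (o := A4o k m P₀ P₁ Eb) fun q hq =>
    inp3_lt (X := F1e k Eb + k.chainT.length) (fun i hi => by rw [k.t_eq]; have := k.tOff_lt (le_refl W) hi; show F1e k Eb + _ < _; omega)
      (fun i _ => (af.hu1 i).trans_le (by omega)) (fun i _ => (af.hn1 i).trans_le (by omega)) hq
  obtain ⟨gA2, rA2⟩ := occC_ext (k := k) (o := A2o k m P₀ P₁ Eb) fun q hq =>
    (inp3_lt (fun i hi => (nodes_lt af.inZ1 le_rfl hi).2.1.trans_le af.hZ1) (fun i _ => af.hu0 i) (fun i _ => af.hn1 i) hq).trans_le (by show Eb ≤ F1e k Eb + _; omega)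
  obtain ⟨gC0, rC0⟩ := occC_ext (k := k) (o := Cc0 k m P₀ P₁ Eb) fun q hq =>
    (inp3_lt (fun i hi => af.hrY i hi) (fun i _ => af.hu0 i) (fun i _ => af.hn1 i) hq).trans_le (by show Eb ≤ F1e k Eb + _; omega)
  have bB : (B0 k m P₀ P₁ Eb).base = F1e k Eb := rfl
  have bA4 : (A4o k m P₀ P₁ Eb).base = F1e k Eb + k.chainT.length := rfl
  have bA2 : (A2o k m P₀ P₁ Eb).base = F1e k Eb + 2 * k.chainT.length := rfl
  have bC0 : (Cc0 k m P₀ P₁ Eb).base = F1e k Eb + 3 * k.chainT.length := rfl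
  rw [bB] at gB; rw [bA4] at gA4; rw [bA2] at gA2; rw [bC0] at gC0
  simp only [bB] at rB; simp only [bA4] at rA4; simp only [bA2] at rA2; simp only [bC0] at rC0
  refine ⟨((gB.append gA4 (by omega) fun e he => (rB e he).2.trans_le le_rfl).append gA2 (by omega) fun e he => ?_).append gC0 (by omega) fun e he => ?_, fun e he => ?_⟩
  · rcases List.mem_append.1 he with he | he
    exacts [(rB e he).2.trans_le (by omega), (rA4 e he).2.trans_le (by omega)]
  · rcases List.mem_append.1 he with he | he
    · rcases List.mem_append.1 he with he | he
      exacts [(rB e he).2.trans_le (by omega), (rA4 e he).2.trans_le (by omega)]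
    · exact (rA2 e he).2.trans_le (by omega)
  · simp only [List.mem_append] at he
    rcases he with ((he | he) | he) | he
    exacts [(rB e he).2.trans_le (by omega), (rA4 e he).2.trans_le (by omega), (rA2 e he).2.trans_le (by omega), (rC0 e he).2.trans_le (by omega)]

/-- Family 3 is well allocated. [folklore] -/
theorem fam3 : FregeSystem.IsExtList (F2e k Eb) ((List.range (W + 1)).flatMap (fun j => (Hs k m P₀ P₁ Eb j).edefs k.chainT (3 * W)) ++
      (List.range (W + 1)).flatMap (fun j => (Ht k m P₀ P₁ Eb j).edefs k.chainT (3 * W)) ++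
      (List.range (W + 1)).flatMap (fun j => (Hp k m P₀ P₁ Eb j).edefs k.chainT (3 * W))) ∧
    ∀ e ∈ (List.range (W + 1)).flatMap (fun j => (Hs k m P₀ P₁ Eb j).edefs k.chainT (3 * W)) ++
      (List.range (W + 1)).flatMap (fun j => (Ht k m P₀ P₁ Eb j).edefs k.chainT (3 * W)) ++
      (List.range (W + 1)).flatMap (fun j => (Hp k m P₀ P₁ Eb j).edefs k.chainT (3 * W)), e.1 < F3e k Eb := by
  obtain ⟨-, -, inHp, -, -, inHs', inHt'⟩ := fam3_facts af
  have eF3 : F3e k Eb = F2e k Eb + (3 * W + 3) * k.chainT.length := rfl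
  have bHs : ∀ j, (Hs k m P₀ P₁ Eb j).base = F2e k Eb + j * k.chainT.length := fun _ => rfl
  have bHt : ∀ j, (Ht k m P₀ P₁ Eb j).base = F2e k Eb + (W + 1 + j) * k.chainT.length := fun _ => rfl
  have bHp : ∀ j, (Hp k m P₀ P₁ Eb j).base = F2e k Eb + (2 * W + 2 + j) * k.chainT.length := fun _ => rfl
  have e1 : F1e k Eb = Eb + (W + 1) * c1 k := rfl
  have e2 : F2e k Eb = F1e k Eb + 4 * k.chainT.length := rfl
  obtain ⟨gHs, gHse⟩ := isExtList_flatMap (st := fun j => F2e k Eb + j * k.chainT.length) (f := fun j => (Hs k m P₀ P₁ Eb j).edefs k.chainT (3 * W))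
    (fun c => Nat.add_le_add_left (Nat.mul_le_mul_right _ (Nat.le_succ c)) _) (W + 1) (fun j hj => (occC_ext (inHs' j (by omega))).1) fun j hj e he => by
      have := ((occC_ext (k := k) (inHs' j (by omega))).2 e he).2; rw [bHs] at this; show e.1 < F2e k Eb + _; rw [Nat.succ_mul]; omega
  obtain ⟨gHt, gHte⟩ := isExtList_flatMap (st := fun j => F2e k Eb + (W + 1 + j) * k.chainT.length) (f := fun j => (Ht k m P₀ P₁ Eb j).edefs k.chainT (3 * W))
    (fun c => Nat.add_le_add_left (Nat.mul_le_mul_right _ (by omega)) _) (W + 1) (fun j hj => (occC_ext (inHt' j (by omega))).1) fun j hj e he => by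
      have := ((occC_ext (k := k) (inHt' j (by omega))).2 e he).2; rw [bHt] at this; show e.1 < F2e k Eb + _
      rw [show W + 1 + (j + 1) = W + 1 + j + 1 by ring, Nat.succ_mul]; omega
  obtain ⟨gHp, gHpe⟩ := isExtList_flatMap (st := fun j => F2e k Eb + (2 * W + 2 + j) * k.chainT.length) (f := fun j => (Hp k m P₀ P₁ Eb j).edefs k.chainT (3 * W))
    (fun c => Nat.add_le_add_left (Nat.mul_le_mul_right _ (by omega)) _) (W + 1)
    (fun j hj => (occC_ext fun q hq => (inHp j (by omega) q hq).trans_le (by rw [bHp, e2, e1]; omega)).1) fun j hj e he => by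
      have := ((occC_ext (k := k) fun q hq => (inHp j (by omega) q hq).trans_le (by rw [bHp, e2, e1]; omega)).2 e he).2; rw [bHp] at this; show e.1 < F2e k Eb + _
      rw [show 2 * W + 2 + (j + 1) = 2 * W + 2 + j + 1 by ring, Nat.succ_mul]; omega
  simp only [Nat.zero_mul, Nat.add_zero] at gHs gHt gHp
  have e3a : F2e k Eb + (W + 1 + (W + 1)) * k.chainT.length = F2e k Eb + (2 * W + 2 + 0) * k.chainT.length := by ring_nf
  have e3b : F2e k Eb + (2 * W + 2 + (W + 1)) * k.chainT.length = F3e k Eb := by rw [eF3]; ring_nf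
  have hm1 : F2e k Eb ≤ F2e k Eb + (W + 1 + 0) * k.chainT.length := Nat.le_add_right _ _
  have hm2 : F2e k Eb ≤ F2e k Eb + (2 * W + 2 + 0) * k.chainT.length := Nat.le_add_right _ _
  refine ⟨(gHs.append gHt hm1 gHse).append gHp hm2 fun e he => ?_, fun e he => ?_⟩
  · rcases List.mem_append.1 he with he | he
    · exact (gHse e he).trans_le (Nat.add_le_add_left (Nat.mul_le_mul_right _ (by omega)) _)
    · have := gHte e he; rwa [e3a] at this
  · rcases List.mem_append.1 he with he | he
    · rcases List.mem_append.1 he with he | he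
      · exact (gHse e he).trans_le (by rw [eF3]; exact Nat.add_le_add_left (Nat.mul_le_mul_right _ (by omega)) _)
      · have := gHte e he; rw [e3a] at this; exact this.trans_le (by rw [eF3]; exact Nat.add_le_add_left (Nat.mul_le_mul_right _ (by omega)) _)
    · have := gHpe e he; rwa [e3b] at this

/-- Family 4 is well allocated. [folklore] -/
theorem fam4 : FregeSystem.IsExtList (F3e k Eb) ((List.range (2 * W + 3)).flatMap (fun c => (List.range (W + 1)).flatMap (domCell k (F4b k Eb c) (chn k m P₀ P₁ Eb c)))) ∧
    ∀ e ∈ (List.range (2 * W + 3)).flatMap (fun c => (List.range (W + 1)).flatMap (domCell k (F4b k Eb c) (chn k m P₀ P₁ Eb c))), e.1 < F4e k Eb := by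
  obtain ⟨-, -, -, hiHs, hiHt, inHs', inHt'⟩ := fam3_facts af
  have eF4b : ∀ c, F4b k Eb c = F3e k Eb + c * (W + 1) * c1 k := fun _ => rfl
  have eF4 : F4e k Eb = F3e k Eb + (2 * W + 3) * (W + 1) * c1 k := rfl
  have l03 : Eb ≤ F3e k Eb := by unfold F3e F2e F1e; omega
  have chn_ok : ∀ c < 2 * W + 3, hiC k (chn k m P₀ P₁ Eb c) ≤ F3e k Eb ∧ ∀ q < 3 * W, (chn k m P₀ P₁ Eb c).inp q < (chn k m P₀ P₁ Eb c).base := by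
    intro c hc; unfold chn; split_ifs with h1 h2
    · exact ⟨af.hZ1.trans l03, af.inZ1⟩
    · exact ⟨hiHs _ (by omega), inHs' _ (by omega)⟩
    · exact ⟨hiHt _ (by omega), inHt' _ (by omega)⟩
  have cell : ∀ c < 2 * W + 3, FregeSystem.IsExtList (F4b k Eb c) ((List.range (W + 1)).flatMap (domCell k (F4b k Eb c) (chn k m P₀ P₁ Eb c))) ∧
      ∀ e ∈ (List.range (W + 1)).flatMap (domCell k (F4b k Eb c) (chn k m P₀ P₁ Eb c)), e.1 < F4b k Eb (c + 1) := by
    intro c hc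
    obtain ⟨hh, hi⟩ := chn_ok c hc
    have hh' : hiC k (chn k m P₀ P₁ Eb c) ≤ F4b k Eb c := hh.trans (by rw [eF4b]; exact Nat.le_add_right _ _)
    have h := isExtList_flatMap (st := fun j' => F4b k Eb c + j' * c1 k) (f := domCell k (F4b k Eb c) (chn k m P₀ P₁ Eb c))
      (fun c => Nat.add_le_add_left (Nat.mul_le_mul_right _ (Nat.le_succ c)) _) (W + 1)
      (fun j' hj' => (isExtList_domCell hh' hi (by omega)).1) fun j' hj' e he => (isExtList_domCell hh' hi (by omega)).2 e he
    simp only [Nat.zero_mul, Nat.add_zero] at h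
    refine ⟨h.1, fun e he => (h.2 e he).trans_le ?_⟩
    rw [eF4b, eF4b]; nlinarith
  have h := isExtList_flatMap (st := fun c => F4b k Eb c) (f := fun c => (List.range (W + 1)).flatMap (domCell k (F4b k Eb c) (chn k m P₀ P₁ Eb c)))
    (fun c => by rw [eF4b, eF4b]; nlinarith) (2 * W + 3) (fun c hc => (cell c hc).1) fun c hc e he => (cell c hc).2 e he
  have e40 : F4b k Eb 0 = F3e k Eb := by rw [eF4b]; simp
  have e4N : F4b k Eb (2 * W + 3) = F4e k Eb := by rw [eF4b, eF4]
  rw [e40, e4N] at h; exact h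

/-- Family 5 is well allocated. [folklore] -/
theorem fam5 : FregeSystem.IsExtList (F4e k Eb) ((List.range (W + 1)).flatMap (fun j' => (uS k m P₀ P₁ Eb j').edefs k.unitA.T k.unitA.nIn ++ (uP k m P₀ P₁ Eb j').edefs k.unitA.T k.unitA.nIn)) ∧
    ∀ e ∈ (List.range (W + 1)).flatMap (fun j' => (uS k m P₀ P₁ Eb j').edefs k.unitA.T k.unitA.nIn ++ (uP k m P₀ P₁ Eb j').edefs k.unitA.T k.unitA.nIn), e.1 < F5e k Eb := by
  obtain ⟨-, -, -, -, hiHt, -, inHt'⟩ := fam3_facts af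
  have hiT0 := hiHt 0 (Nat.zero_le W)
  have l34 : F3e k Eb ≤ F4e k Eb := Nat.le_add_right _ _
  have eF5 : F5e k Eb = F4e k Eb + (W + 1) * c5 k := rfl
  have h := isExtList_flatMap (st := fun j' => F4e k Eb + j' * c5 k)
    (f := fun j' => (uS k m P₀ P₁ Eb j').edefs k.unitA.T k.unitA.nIn ++ (uP k m P₀ P₁ Eb j').edefs k.unitA.T k.unitA.nIn)
    (fun c => Nat.add_le_add_left (Nat.mul_le_mul_right _ (Nat.le_succ c)) _) (W + 1) (fun j' hj' => ?_) (fun j' hj' e he => ?_)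
  rotate_left
  · have hS : ∀ q < k.unitA.nIn, (uS k m P₀ P₁ Eb j').inp q < F4e k Eb + j' * c5 k := fun q hq =>
      ((srcVal_lt (os := fun _ => k.So (Ht k m P₀ P₁ Eb 0) j') (k.unitA_ok q hq) (fun r _ q' hq' => (SoPo_inp_lt (inHt' 0 (Nat.zero_le W)) (by omega) hq').1)
        fun r _ g hg => (SoPo_gate_lt (by omega) hg).1).trans_le hiT0).trans_le (l34.trans (Nat.le_add_right _ _))
    have hP : ∀ q < k.unitA.nIn, (uP k m P₀ P₁ Eb j').inp q < F4e k Eb + j' * c5 k + k.unitA.T.length := fun q hq =>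
      ((srcVal_lt (os := fun _ => k.Po (Ht k m P₀ P₁ Eb 0) j') (k.unitA_ok q hq) (fun r _ q' hq' => (SoPo_inp_lt (inHt' 0 (Nat.zero_le W)) (by omega) hq').2)
        fun r _ g hg => (SoPo_gate_lt (by omega) hg).2).trans_le hiT0).trans_le (l34.trans (by omega))
    have e1 := (uS k m P₀ P₁ Eb j').isExtList_edefs k.unitA_wf hS le_rfl
    have e2 := (uP k m P₀ P₁ Eb j').isExtList_edefs k.unitA_wf hP le_rfl
    have r1 := fun e (he : e ∈ (uS k m P₀ P₁ Eb j').edefs k.unitA.T k.unitA.nIn) => Occ.fst_mem_edefs he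
    have bS : (uS k m P₀ P₁ Eb j').base = F4e k Eb + j' * c5 k := rfl
    have bP : (uP k m P₀ P₁ Eb j').base = F4e k Eb + j' * c5 k + k.unitA.T.length := rfl
    rw [bS] at e1; rw [bP] at e2; simp only [bS] at r1
    exact e1.append e2 (by omega) fun e he => (r1 e he).2.trans_le le_rfl
  · have r1 := fun e (he : e ∈ (uS k m P₀ P₁ Eb j').edefs k.unitA.T k.unitA.nIn) => Occ.fst_mem_edefs he
    have r2 := fun e (he : e ∈ (uP k m P₀ P₁ Eb j').edefs k.unitA.T k.unitA.nIn) => Occ.fst_mem_edefs he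
    have bS : (uS k m P₀ P₁ Eb j').base = F4e k Eb + j' * c5 k := rfl
    have bP : (uP k m P₀ P₁ Eb j').base = F4e k Eb + j' * c5 k + k.unitA.T.length := rfl
    simp only [bS] at r1; simp only [bP] at r2
    show e.1 < F4e k Eb + (j' + 1) * c5 k
    have e5 : (j' + 1) * c5 k = j' * c5 k + (k.unitA.T.length + k.unitA.T.length) := by simp only [c5]; ring
    rcases List.mem_append.1 he with he | he
    · have := (r1 e he).2; rw [e5]; omega
    · have := (r2 e he).2; rw [e5]; omega
  simp only [Nat.zero_mul, Nat.add_zero] at h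
  rw [← eF5] at h; exact h

/-- Families 6 and 7 are well allocated. [folklore] -/
theorem fam67 : (FregeSystem.IsExtList (F6b k Eb) (distDefs k m P₁ (F6b k Eb) (HsF k m P₀ P₁ Eb) (HsF k m P₀ P₁ Eb)) ∧
      ∀ e ∈ distDefs k m P₁ (F6b k Eb) (HsF k m P₀ P₁ Eb) (HsF k m P₀ P₁ Eb), e.1 < F7b k Eb) ∧
    (FregeSystem.IsExtList (F7b k Eb) (distDefs k m P₁ (F7b k Eb) (HtF k m P₀ P₁ Eb) (HsF k m P₀ P₁ Eb)) ∧
      ∀ e ∈ distDefs k m P₁ (F7b k Eb) (HtF k m P₀ P₁ Eb) (HsF k m P₀ P₁ Eb), e.1 < Eend k Eb) := by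
  obtain ⟨-, -, -, hiHs, hiHt, inHs', inHt'⟩ := fam3_facts af
  have l35 : F3e k Eb ≤ F5e k Eb := (Nat.le_add_right _ _).trans (Nat.le_add_right _ _)
  have l05 : Eb ≤ F5e k Eb := by unfold F5e F4e F3e F2e F1e; omega
  have hFce : ∀ b, b ≤ Fce k b := fun b => by unfold Fce Fbe Fae; omega
  have l57 : F5e k Eb ≤ F7b k Eb := hFce _
  refine ⟨isExtList_distDefs (fun j hj => ⟨(hiHs j hj).trans l35, inHs' j hj⟩) (fun j hj => ⟨(hiHs j hj).trans l35, inHs' j hj⟩) fun i => (af.hn1 i).trans_le l05,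
    isExtList_distDefs (fun j hj => ⟨(hiHt j hj).trans (l35.trans l57), inHt' j hj⟩) (fun j hj => ⟨(hiHs j hj).trans (l35.trans l57), inHs' j hj⟩)
      fun i => (af.hn1 i).trans_le (l05.trans l57)⟩

/-- **The extension list of the refutation is well allocated above `Eb`.** [cite: CookReckhow1979, Def. 4.1] -/
theorem isExtList_E : FregeSystem.IsExtList Eb (E k m P₀ P₁ Eb) ∧ ∀ e ∈ E k m P₀ P₁ Eb, e.1 < Eend k Eb := by
  obtain ⟨g1, g1e⟩ := fam1 af
  obtain ⟨g2, g2e⟩ := fam2 af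
  obtain ⟨g3, g3e⟩ := fam3 af
  obtain ⟨g4, g4e⟩ := fam4 af
  obtain ⟨g5, g5e⟩ := fam5 af
  obtain ⟨⟨g6, g6e⟩, ⟨g7, g7e⟩⟩ := fam67 af
  have l01 : Eb ≤ F1e k Eb := Nat.le_add_right _ _
  have l12 : F1e k Eb ≤ F2e k Eb := Nat.le_add_right _ _
  have l23 : F2e k Eb ≤ F3e k Eb := Nat.le_add_right _ _
  have l34 : F3e k Eb ≤ F4e k Eb := Nat.le_add_right _ _
  have l45 : F4e k Eb ≤ F5e k Eb := Nat.le_add_right _ _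
  have hFce : ∀ b, b ≤ Fce k b := fun b => by unfold Fce Fbe Fae; omega
  have l57 : F5e k Eb ≤ F7b k Eb := hFce _
  have l7E : F7b k Eb ≤ Eend k Eb := hFce _
  have x1 : ∀ e ∈ (List.range (W + 1)).flatMap (domCell k Eb (A1 k m P₁)) ++ ((B0 k m P₀ P₁ Eb).edefs k.chainT (3 * W) ++ (A4o k m P₀ P₁ Eb).edefs k.chainT (3 * W) ++
      (A2o k m P₀ P₁ Eb).edefs k.chainT (3 * W) ++ (Cc0 k m P₀ P₁ Eb).edefs k.chainT (3 * W)), e.1 < F2e k Eb := fun e he => by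
    rcases List.mem_append.1 he with he | he
    exacts [(g1e e he).trans_le l12, g2e e he]
  have y1 := g1.append g2 l01 g1e
  have y2 := y1.append g3 (l01.trans l12) x1
  have x2 := fun e (he : e ∈ _ ++ _) => (List.mem_append.1 he).elim (fun he => (x1 e he).trans_le l23) fun he => g3e e he
  have y3 := y2.append g4 (l01.trans (l12.trans l23)) x2
  have x3 := fun e (he : e ∈ _ ++ _) => (List.mem_append.1 he).elim (fun he => (x2 e he).trans_le l34) fun he => g4e e he
  have y4 := y3.append g5 (l01.trans (l12.trans (l23.trans l34))) x3
  have x4 := fun e (he : e ∈ _ ++ _) => (List.mem_append.1 he).elim (fun he => (x3 e he).trans_le l45) fun he => g5e e he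
  have y5 := y4.append g6 (l01.trans (l12.trans (l23.trans (l34.trans l45)))) x4
  have x5 := fun e (he : e ∈ _ ++ _) => (List.mem_append.1 he).elim (fun he => (x4 e he).trans_le l57) fun he => g6e e he
  have y6 := y5.append g7 (l01.trans (l12.trans (l23.trans (l34.trans (l45.trans l57))))) x5
  have x6 := fun e (he : e ∈ _ ++ _) => (List.mem_append.1 he).elim (fun he => (x5 e he).trans_le l7E) fun he => g7e e he
  exact ⟨y6, x6⟩

end Alloc

/-! ### The variables of the constraint sets -/

section Vars

/-- **Variables of the definitions of an occurrence**: inputs or own gates. [folklore] -/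
theorem vars_edefs {o : Occ} {t : Template} {nIn : ℕ} (hwf : t.WF nIn) {e : ℕ × PropForm ℕ} (he : e ∈ o.edefs t nIn) {x : ℕ}
    (hx : x ∈ (biimp (var e.1) e.2).vars) : (∃ i < nIn, x = o.inp i) ∨ (o.base ≤ x ∧ x < o.base + t.length) := by
  obtain ⟨g, hg, rfl⟩ := ((o.inst nIn).mem_defs_iff t).1 he
  rcases FregeSystem.mem_vars_biimp.1 hx with hx | hx
  · simp only [vars, Finset.mem_singleton] at hx; subst hx
    exact Or.inr ⟨Nat.le_add_right _ _, by show o.base + g < _; omega⟩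
  · obtain ⟨a, ha, hxa⟩ := Kind.mem_vars_body hx
    obtain ⟨r, hr, rfl⟩ := List.mem_map.1 ha
    simp only [vars, Finset.mem_singleton] at hxa; subst hxa
    obtain ⟨h₁, h₂⟩ := (hwf g hg).2 r hr
    cases r with
    | inl i => exact Or.inl ⟨i, h₁ i rfl, by simp only [Inst.ref]; rw [o.getD_inst (h₁ i rfl)]⟩
    | inr j => have := h₂ j rfl; exact Or.inr ⟨by simp only [Inst.ref, Inst.wire, Occ.base_inst]; omega, by simp only [Inst.ref, Inst.wire, Occ.base_inst]; omega⟩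

variable (k m) {P : ℕ} (hP : 3 * m ≤ P) (hW : 0 < W)
include hP hW

/-- The block of variables of a copy. [folklore] -/
def InCopy (k : ModAdd.OpKit W) (m P x : ℕ) : Prop := x < 3 * m ∨ (P ≤ x ∧ x < bEnd k m P)

omit hP hW in
/-- Gates of the block are in the copy. [folklore] -/
theorem inCopy_of_mem_block {x : ℕ} (h1 : P ≤ x) (h2 : x < bEnd k m P) : InCopy k m P x := Or.inr ⟨h1, h2⟩

/-- **The variables of the computing definitions are in the copy.** [folklore] -/
theorem inCopy_compDefs {e : ℕ × PropForm ℕ} (he : e ∈ compDefs k m P) {x : ℕ} (hx : x ∈ (biimp (var e.1) e.2).vars) : InCopy k m P x := by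
  have hb := bases (k := k) (m := m) (P := P) (W := W)
  have hw := words_lt m hP
  obtain ⟨inY, inA, inZ, inX⟩ := inps_lt k m (P := P) hP
  have h2 := two_T_le (k := k) hW
  have hE : bEnd k m P = bC k m P + 3 * (3 * W + 1) := rfl
  -- inputs of the four occurrences are atoms or in the block
  have key : ∀ {o : Occ} {t : Template} (hwf : t.WF (3 * W)) (hin : ∀ q < 3 * W, InCopy k m P (o.inp q)) (hlo : P ≤ o.base) (hhi : o.base + t.length ≤ bEnd k m P),
      e ∈ o.edefs t (3 * W) → InCopy k m P x := by
    intro o t hwf hin hlo hhi he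
    rcases vars_edefs hwf he hx with ⟨i, hi, rfl⟩ | ⟨h1, h2⟩
    · exact hin i hi
    · exact Or.inr ⟨hlo.trans h1, h2.trans_le hhi⟩
  have wn : ∀ i, InCopy k m P (nw m P i) := fun i => by unfold nw zv; split_ifs <;> [exact Or.inl (by omega); exact Or.inr ⟨by omega, by omega⟩]
  have we : ∀ i, InCopy k m P (ew m P i) := fun i => by unfold ew zv; split_ifs <;> [exact Or.inl (by omega); exact Or.inr ⟨by omega, by omega⟩]
  have wy : ∀ i, InCopy k m P (yw m P i) := fun i => by unfold yw zv; split_ifs <;> [exact Or.inl (by omega); exact Or.inr ⟨by omega, by omega⟩]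
  have wu : ∀ i, InCopy k m P (uw m P i) := fun i => by unfold uw zv; split_ifs <;> exact Or.inr ⟨by omega, by omega⟩
  have wo : ∀ i, InCopy k m P (onew m P i) := fun i => by unfold onew ov zv; split_ifs <;> exact Or.inr ⟨by omega, by omega⟩
  have in3 : ∀ {xw yw' nw' : ℕ → ℕ}, (∀ i < W, InCopy k m P (xw i)) → (∀ i, InCopy k m P (yw' i)) → (∀ i, InCopy k m P (nw' i)) → ∀ q < 3 * W, InCopy k m P (inp3 (W := W) xw yw' nw' q) := by
    intro xw yw' nw' hx hy hn q hq; unfold inp3; split_ifs with c1 c2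
    · exact hx q c1
    · exact hy _
    · exact hn _
  simp only [compDefs, List.mem_append] at he
  rcases he with (((he | he) | he) | he) | he
  · -- the zero gate
    obtain ⟨g, hg, rfl⟩ := (((ZO m P).inst 0).mem_defs_iff _).1 he
    have hg0 : g = 0 := by simpa using hg
    subst hg0
    rcases FregeSystem.mem_vars_biimp.1 hx with hx | hx
    · simp only [vars, Finset.mem_singleton] at hx; subst hx; exact Or.inr ⟨by show P ≤ P + m + 0; omega, by show P + m + 0 < _; omega⟩
    · simp [Inst.body, getElem_constRow, Kind.body, vars] at hx
  · exact key k.wf (in3 (fun i _ => wo i) wy wn) (by show P ≤ bY m P; omega) (by show bY m P + _ ≤ _; omega) he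
  · exact key k.wf_chainT (in3 (fun i hi => Or.inr ⟨by show P ≤ bY m P + _; omega, by have := k.resOff_lt i hi; show bY m P + _ < _; omega⟩) we wn)
      (by show P ≤ bA k m P; omega) (by show bA k m P + _ ≤ _; omega) he
  · exact key k.wf_chainT (in3 (fun i hi => Or.inr ⟨by rw [k.t_eq]; show P ≤ bA k m P + _; omega,
      by have := k.tOff_lt (le_refl W) hi; rw [k.t_eq]; show bA k m P + _ < _; omega⟩) wu wn)
      (by show P ≤ bZ k m P; omega) (by show bZ k m P + _ ≤ _; omega) he
  · exact key k.wf_chainT (in3 (fun i hi => Or.inr ⟨by show P ≤ bY m P + _; omega, by have := k.resOff_lt i hi; show bY m P + _ < _; omega⟩) wu wn)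
      (by show P ≤ bX k m P; omega) (by show bX k m P + _ ≤ _; omega) he

/-- The variables of the comparators are in the copy. [folklore] -/
theorem inCopy_cmpDefs {e : ℕ × PropForm ℕ} (he : e ∈ cmpDefs k m P) {x : ℕ} (hx : x ∈ (biimp (var e.1) e.2).vars) : InCopy k m P x := by
  have hb := bases (k := k) (m := m) (P := P) (W := W)
  have hw := words_lt m hP
  have hE : bEnd k m P = bC k m P + 3 * (3 * W + 1) := rfl
  have key : ∀ {o : Occ} (hin : ∀ q < 2 * W, InCopy k m P (o.inp q)) (hlo : P ≤ o.base) (hhi : o.base + (Sub.subT W).length ≤ bEnd k m P),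
      e ∈ o.edefs (Sub.subT W) (2 * W) → InCopy k m P x := by
    intro o hin hlo hhi he
    rcases vars_edefs (Sub.wf_subT W) he hx with ⟨i, hi, rfl⟩ | ⟨h1, h2⟩
    · exact hin i hi
    · exact Or.inr ⟨hlo.trans h1, h2.trans_le hhi⟩
  have wn : ∀ i, InCopy k m P (nw m P i) := fun i => by unfold nw zv; split_ifs <;> [exact Or.inl (by omega); exact Or.inr ⟨by omega, by omega⟩]
  have wo : ∀ i, InCopy k m P (onew m P i) := fun i => by unfold onew ov zv; split_ifs <;> exact Or.inr ⟨by omega, by omega⟩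
  have in2 : ∀ {xw nw' : ℕ → ℕ}, (∀ i < W, InCopy k m P (xw i)) → (∀ i, InCopy k m P (nw' i)) → ∀ q < 2 * W, InCopy k m P (inp2 (W := W) xw nw' q) := by
    intro xw nw' hx hn q hq; unfold inp2; split_ifs with c1
    · exact hx q c1
    · exact hn _
  simp only [cmpDefs, List.mem_append] at he
  rcases he with (he | he) | he
  · exact key (in2 (fun i _ => Or.inr ⟨by show P ≤ zv m P; unfold zv; omega, by show zv m P < _; unfold zv; omega⟩) wn) (by show P ≤ bC k m P; omega)
      (by show bC k m P + _ ≤ _; simp; omega) he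
  · exact key (in2 (fun i _ => wo i) wn) (by show P ≤ bC k m P + _; omega) (by show bC k m P + _ + _ ≤ _; simp; omega) he
  · exact key (in2 (fun i hi => Or.inr ⟨by show P ≤ bY m P + _; omega, by have := k.resOff_lt i hi; show bY m P + _ < _; omega⟩) wn)
      (by show P ≤ bC k m P + _; omega) (by show bC k m P + _ + _ ≤ _; simp; omega) he

omit hP in
/-- The variables of the gadget's definitions are in the copy. [folklore] -/
theorem inCopy_orDefs {e : ℕ × PropForm ℕ} (he : e ∈ (ORo m P).edefs (orT m) m) {x : ℕ} (hx : x ∈ (biimp (var e.1) e.2).vars) : InCopy k m P x := by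
  have hb := bases (k := k) (m := m) (P := P) (W := W)
  rcases vars_edefs (wf_orT m) he hx with ⟨i, hi, hxi⟩ | ⟨h1, h2⟩
  · rw [hxi]; exact Or.inl (by show i < 3 * m; omega)
  · refine Or.inr ⟨?_, ?_⟩
    · show P ≤ x; change P + m + 1 ≤ x at h1; omega
    · change x < P + m + 1 + (orT m).length at h2; simp at h2; show x < bEnd k m P; omega

omit hP hW in
/-- The variables of the certificate are in the copy. [folklore] -/
theorem inCopy_certZ {c : PropForm ℕ} (hc : c ∈ certZ k m P) {x : ℕ} (hx : x ∈ c.vars) : InCopy k m P x := by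
  have hb := bases (k := k) (m := m) (P := P) (W := W)
  obtain ⟨i, hi, rfl⟩ := List.mem_map.1 hc
  rw [List.mem_range] at hi
  simp only [eqv, FregeSystem.mem_vars_biimp, vars, Finset.mem_singleton] at hx
  rcases hx with rfl | rfl
  · have := k.tOff_lt (le_refl W) hi; rw [k.t_eq]; exact Or.inr ⟨by show P ≤ bZ k m P + _; omega, by show bZ k m P + _ < _; omega⟩
  · have := k.resOff_lt i hi; exact Or.inr ⟨by show P ≤ bY m P + _; omega, by show bY m P + _ < _; omega⟩

/-- **The variables of `T₀` are atoms or in block `0`.** [folklore] -/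
theorem inCopy_T0 {c : PropForm ℕ} (hc : c ∈ T0 k m P) {x : ℕ} (hx : x ∈ c.vars) : InCopy k m P x := by
  have hb := bases (k := k) (m := m) (P := P) (W := W)
  simp only [T0, List.mem_append, List.mem_map] at hc
  rcases hc with hc | ⟨c, hc, rfl⟩
  · obtain ⟨e, he, rfl⟩ := List.mem_map.1 hc
    exact inCopy_orDefs k m hW he hx
  · simp only [vars, Finset.mem_union, Finset.mem_singleton] at hx
    rcases hx with hx | rfl
    · simp only [List.mem_singleton] at hc
      rcases hc with (hc | hc) | rfl
      · obtain ⟨e, he, rfl⟩ := List.mem_map.1 hc; exact inCopy_compDefs k m hP hW he hx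
      · exact inCopy_certZ k m hc hx
      · simp only [vars, Finset.mem_singleton] at hx; subst hx
        have := k.tOff_lt (le_refl W) hW; rw [k.t_eq]; exact Or.inr ⟨by show P ≤ bX k m P + _; omega, by show bX k m P + _ < _; omega⟩
    · exact Or.inr ⟨by show P ≤ ov m P; unfold ov; omega, by show ov m P < _; unfold ov; omega⟩

/-- **The variables of `T₁` are atoms or in block `1`.** [folklore] -/
theorem inCopy_T1 {c : PropForm ℕ} (hc : c ∈ T1 k m P) {x : ℕ} (hx : x ∈ c.vars) : InCopy k m P x := by
  have hb := bases (k := k) (m := m) (P := P) (W := W)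
  simp only [T1, List.mem_append, List.mem_cons, List.not_mem_nil, or_false] at hc
  rcases hc with (hc | hc) | rfl | rfl | rfl | rfl | rfl
  · obtain ⟨e, he, rfl⟩ := List.mem_map.1 hc
    simp only [List.mem_append] at he
    rcases he with (he | he) | he
    exacts [inCopy_orDefs k m hW he hx, inCopy_compDefs k m hP hW he hx, inCopy_cmpDefs k m hP hW he hx]
  · exact inCopy_certZ k m hc hx
  · simp only [vars, Finset.mem_singleton] at hx; subst hx
    have := k.tOff_lt (le_refl W) hW; rw [k.t_eq]; exact Or.inr ⟨by show P ≤ bX k m P + _; omega, by show bX k m P + _ < _; omega⟩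
  · simp only [vars, Finset.mem_singleton] at hx; subst hx
    exact Or.inr ⟨by show P ≤ ov m P; unfold ov; omega, by show ov m P < _; unfold ov; omega⟩
  all_goals
    simp only [vars, Finset.mem_singleton] at hx; subst hx; rw [ge_eq]
    first
    | exact Or.inr ⟨by show P ≤ bC k m P + 3 * W; omega, by show bC k m P + 3 * W < bEnd k m P; omega⟩
    | exact Or.inr ⟨by show P ≤ bC k m P + (3 * W + 1) + 3 * W; omega, by show bC k m P + (3 * W + 1) + 3 * W < bEnd k m P; omega⟩
    | exact Or.inr ⟨by show P ≤ bC k m P + 2 * (3 * W + 1) + 3 * W; omega, by show bC k m P + 2 * (3 * W + 1) + 3 * W < bEnd k m P; omega⟩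

end Vars

/-! ### The proof system of the construction -/

/-- The rules of the construction: scaffold, arithmetic/chain rules, kit rules, assembly rules. [folklore] -/
def sys (k : ModAdd.OpKit W) : FregeSystem := ⟨Scaffold.rules ++ allRulesC ++ k.ruleList ++ rules⟩

/-- **The system is sound.** [cite: CookReckhow1979, §2] -/
theorem isSound_sys (k : ModAdd.OpKit W) : (sys k).IsSound := by
  intro r hr
  simp only [sys, List.mem_append] at hr
  rcases hr with ((hr | hr) | hr) | hr
  exacts [Scaffold.isSound_of_mem_rules r hr, isSound_allRulesC r hr, k.rules_sound r hr, isSound_of_mem_rules r hr]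

/-- The system contains the four rule groups. [folklore] -/
theorem sys_rules (k : ModAdd.OpKit W) : (∀ r ∈ Scaffold.rules, r ∈ (sys k).rules) ∧ CRulesOK (sys k) ∧ k.Rules (sys k) ∧ ∀ r ∈ rules, r ∈ (sys k).rules :=
  ⟨fun r hr => by simp [sys, hr], cRulesOK_of_subset fun r hr => by simp [sys, hr], k.rules_of fun r hr => by simp [sys, hr], fun r hr => by simp [sys, hr]⟩

/-! ### The `EF`-proof at bit length `m` -/

/-- Base of block `1`. [folklore] -/
def P1 (k : ModAdd.OpKit W) (m : ℕ) : ℕ := bEnd k m (3 * m)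
/-- The context variable (above all variables of `T₀, T₁`). [folklore] -/
def kap (k : ModAdd.OpKit W) (m : ℕ) : ℕ := bEnd k m (P1 k m)

/-- The block of a copy starts after the atoms. [folklore] -/
theorem le_bEnd (P : ℕ) : P ≤ bEnd k m P := by simp only [bEnd, bC, bX, bZ, bA, bY]; omega

/-- **The `EF`-proof of `¬⋀T₀ ∨ ¬⋀T₁` in the system of the construction**, with its size.
[cite: KrajicekPudlak1998, Thm. 1, Cor. 10] -/
theorem exists_proof (hW : 0 < W) (hkm : m ≤ k.m) :
    ∃ π : List (PropForm ℕ), (sys k).IsEFProofOf π (Scaffold.target (T0 k m (3 * m)) (T1 k m (P1 k m))) ∧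
      proofSize π ≤ Scaffold.sizeBound (T0 k m (3 * m)) (T1 k m (P1 k m)) (E k m (3 * m) (P1 k m) (kap k m + 1)) + refSize k m 1 + 3 := by
  obtain ⟨hS, hC, hK, hR⟩ := sys_rules k
  have hT0 : ∀ c ∈ T0 k m (3 * m), ctx (var (kap k m)) c ∈ Scaffold.Avail (T0 k m (3 * m)) (T1 k m (P1 k m)) (kap k m) (E k m (3 * m) (P1 k m) (kap k m + 1)) :=
    fun c hc => Or.inl ⟨c, List.mem_append_left _ hc, rfl⟩
  have hT1 : ∀ c ∈ T1 k m (P1 k m), ctx (var (kap k m)) c ∈ Scaffold.Avail (T0 k m (3 * m)) (T1 k m (P1 k m)) (kap k m) (E k m (3 * m) (P1 k m) (kap k m + 1)) :=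
    fun c hc => Or.inl ⟨c, List.mem_append_right _ hc, rfl⟩
  have hE : ∀ e ∈ E k m (3 * m) (P1 k m) (kap k m + 1),
      ctx (var (kap k m)) (biimp (var e.1) e.2) ∈ Scaffold.Avail (T0 k m (3 * m)) (T1 k m (P1 k m)) (kap k m) (E k m (3 * m) (P1 k m) (kap k m + 1)) :=
    fun e he => Or.inr ⟨e, he, rfl⟩
  obtain ⟨D, hD, hsub, hsize⟩ := refute hC hK hR hW hkm hT0 hT1 hE
  have hbot := hsub rfl
  have hD' := hD.snoc (θ := ctx (var (kap k m)) (const false)) (Or.inl hbot)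
  -- the bound of the target and the allocation
  have hP1 : 3 * m ≤ P1 k m := le_bEnd _
  have hκv : (Scaffold.target (T0 k m (3 * m)) (T1 k m (P1 k m))).bound ≤ kap k m := by
    refine bound_le_of_forall_lt fun x hx => ?_
    simp only [Scaffold.target, vars, Finset.mem_union, mem_vars_bigAnd] at hx
    rcases hx with ⟨c, hc, hx⟩ | ⟨c, hc, hx⟩
    · rcases inCopy_T0 k m le_rfl hW hc hx with h | ⟨-, h⟩
      · exact lt_of_lt_of_le h (hP1.trans (le_bEnd _))
      · exact h.trans_le (le_bEnd (k := k) (m := m) (P1 k m))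
    · rcases inCopy_T1 k m hP1 hW hc hx with h | ⟨-, h⟩
      · exact lt_of_lt_of_le h (hP1.trans (le_bEnd _))
      · exact h
  have hEl := (isExtList_E (allocFacts (k := k) (m := m) (P₀ := 3 * m) (P₁ := P1 k m) (Eb := kap k m + 1) hW le_rfl hP1 le_rfl (Nat.le_succ _))).1
  obtain ⟨π, hπ, hsz⟩ := Scaffold.exists_isEFProofOf_le hS hκv hEl hD' (List.mem_append_right _ (List.mem_singleton_self _))
  refine ⟨π, hπ, hsz.trans ?_⟩
  rw [proofSize_append, proofSize_singleton]
  simp only [ctx, size] at hsize ⊢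
  omega

/-! ### Size analysis: everything is polynomial in the kit size and `m` -/

section Size

/-- The size measure of a kit: width, template lengths and size coefficients. [folklore] -/
def KS (k : ModAdd.OpKit W) : ℕ :=
  W + k.T.length + k.domA.T.length + k.unitA.T.length + k.medA.T.length + k.domC.1 + k.domC.2 + k.unitC.1 + k.unitC.2 + k.medC.1 + k.medC.2

/-- Bounds of the form `x ≤ c · S^d` compose under products. [folklore] -/
theorem bmul {S x y c c' d d' : ℕ} (hx : x ≤ c * S ^ d) (hy : y ≤ c' * S ^ d') : x * y ≤ (c * c') * S ^ (d + d') := by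
  calc x * y ≤ (c * S ^ d) * (c' * S ^ d') := Nat.mul_le_mul hx hy
    _ = (c * c') * S ^ (d + d') := by rw [pow_add]; ring

/-- Bounds of the form `x ≤ c · S^d` compose under sums (same degree). [folklore] -/
theorem badd {S x y c c' d : ℕ} (hx : x ≤ c * S ^ d) (hy : y ≤ c' * S ^ d) : x + y ≤ (c + c') * S ^ d := by rw [Nat.add_mul]; exact Nat.add_le_add hx hy

/-- Raising the degree (`S ≥ 1`). [folklore] -/
theorem bdeg {S x c d d' : ℕ} (hS : 1 ≤ S) (hx : x ≤ c * S ^ d) (hd : d ≤ d') : x ≤ c * S ^ d' := hx.trans (Nat.mul_le_mul_left _ (Nat.pow_le_pow_right hS hd))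

/-- Constants (`S ≥ 1`). [folklore] -/
theorem bconst {S d : ℕ} (hS : 1 ≤ S) (n : ℕ) : n ≤ n * S ^ d := Nat.le_mul_of_pos_right _ (Nat.pow_pos hS)

/-- Atoms below `S`. [folklore] -/
theorem batom {S x : ℕ} (hx : x ≤ S) : x ≤ 1 * S ^ 1 := by simpa using hx

variable (k m)

/-- The master size parameter. [folklore] -/
def SS : ℕ := KS k + m + 2

/-- The basic quantities are below `S`. [folklore] -/
theorem atoms_le : 1 ≤ SS k m ∧ W ≤ SS k m ∧ m ≤ SS k m ∧ k.T.length ≤ SS k m ∧ k.domA.T.length ≤ SS k m ∧ k.unitA.T.length ≤ SS k m ∧ k.medA.T.length ≤ SS k m ∧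
    k.domC.1 ≤ SS k m ∧ k.domC.2 ≤ SS k m ∧ k.unitC.1 ≤ SS k m ∧ k.unitC.2 ≤ SS k m ∧ k.medC.1 ≤ SS k m ∧ k.medC.2 ≤ SS k m ∧ W + 2 ≤ SS k m := by
  simp only [SS, KS]; omega

/-- The chain length is `≤ 8 S²`. [folklore] -/
theorem chainT_le : k.chainT.length ≤ 8 * SS k m ^ 2 := by
  obtain ⟨h1, hW, -, hL, -⟩ := atoms_le k m
  rw [k.length_chainT]; unfold OpKit.offS OpKit.B
  nlinarith

variable {k m}

/-- The computing definitions are `≤ 26 S²` lines. [folklore] -/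
theorem compDefs_le (P : ℕ) : (compDefs k m P).length ≤ 26 * SS k m ^ 2 := by
  obtain ⟨h1, -, -, hL, -⟩ := atoms_le k m
  have hLc := chainT_le k m
  rw [length_compDefs]; nlinarith

/-- `|T₀| ≤ 29 S²`, `|T₁| ≤ 45 S²`. [folklore] -/
theorem T_le : (T0 k m (3 * m)).length ≤ 29 * SS k m ^ 2 ∧ (T1 k m (P1 k m)).length ≤ 45 * SS k m ^ 2 := by
  obtain ⟨h1, hW, hm, -⟩ := atoms_le k m
  have hc0 := compDefs_le (k := k) (m := m) (3 * m); have hc1 := compDefs_le (k := k) (m := m) (P1 k m)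
  have lor : ∀ P, ((ORo m P).edefs (orT m) m).length ≤ SS k m := fun P => by simp only [Occ.length_edefs, length_orT]; omega
  have lcmp : (cmpDefs k m (P1 k m)).length ≤ 12 * SS k m := by simp only [cmpDefs, List.length_append, Occ.length_edefs, Sub.length_subT]; omega
  have hS : SS k m ≤ SS k m ^ 2 := by nlinarith
  constructor
  · simp only [T0, List.length_append, List.length_map, extAxioms, certZ, eqW, List.length_range, List.length_singleton]
    have := lor (3 * m); nlinarith
  · simp only [T1, List.length_append, List.length_map, extAxioms, certZ, eqW, List.length_range, List.length_cons, List.length_nil]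
    have := lor (P1 k m); nlinarith

/-- The extension lines of the copies are small. [folklore] -/
theorem size_ext_le {P : ℕ} {e : ℕ × PropForm ℕ} (he : e ∈ (ORo m P).edefs (orT m) m ++ compDefs k m P ++ cmpDefs k m P) : (biimp (var e.1) e.2).size ≤ 57 := by
  have hb : e.2.size ≤ 25 := by
    rcases List.mem_append.1 he with he | he
    · rcases List.mem_append.1 he with he | he
      exacts [Occ.size_of_mem_edefs he, size_of_mem_compDefs he]
    · simp only [cmpDefs, List.mem_append] at he
      rcases he with (he | he) | he <;> exact Occ.size_of_mem_edefs he
  rw [FregeSystem.size_biimp]; simp [size]; omega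

/-- The constraints are small (`≤ 60` symbols). [folklore] -/
theorem size_T_le : (∀ c ∈ T0 k m (3 * m), c.size ≤ 60) ∧ ∀ c ∈ T1 k m (P1 k m), c.size ≤ 60 := by
  constructor
  · intro c hc
    rcases List.mem_append.1 hc with hc | hc
    · obtain ⟨e, he, rfl⟩ := List.mem_map.1 hc
      exact (size_ext_le (k := k) (List.mem_append_left _ (List.mem_append_left _ he))).trans (by norm_num)
    · obtain ⟨c', hc', rfl⟩ := List.mem_map.1 hc
      simp only [size]
      rcases List.mem_append.1 hc' with hc' | hc'
      · rcases List.mem_append.1 hc' with hc' | hc'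
        · obtain ⟨e, he, rfl⟩ := List.mem_map.1 hc'
          have := size_ext_le (k := k) (List.mem_append_left _ (List.mem_append_right _ he)); omega
        · obtain ⟨i, -, rfl⟩ := List.mem_map.1 hc'; rw [size_eqv]; norm_num
      · rw [List.mem_singleton] at hc'; subst hc'; simp [size]
  · intro c hc
    rcases List.mem_append.1 hc with hc | hc
    · rcases List.mem_append.1 hc with hc | hc
      · obtain ⟨e, he, rfl⟩ := List.mem_map.1 hc
        exact (size_ext_le (k := k) he).trans (by norm_num)
      · obtain ⟨i, -, rfl⟩ := List.mem_map.1 hc; rw [size_eqv]; norm_num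
    · simp only [List.mem_cons, List.not_mem_nil, or_false] at hc
      rcases hc with rfl | rfl | rfl | rfl | rfl <;> simp [size]

/-- Big conjunctions of small constraints. [folklore] -/
theorem size_bigAnd_le {T : List (PropForm ℕ)} (hT : ∀ c ∈ T, c.size ≤ 60) : (bigAnd T).size ≤ 61 * T.length + 1 := by
  rw [size_bigAnd]
  have : (T.map size).sum ≤ 60 * T.length := by
    have h := List.sum_le_card_nsmul (T.map size) 60 fun x hx => by obtain ⟨c, hc, rfl⟩ := List.mem_map.1 hx; exact hT c hc
    rw [List.length_map, smul_eq_mul] at h; linarith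
  omega

/-- The target is `≤ 4600 S²` symbols. [folklore] -/
theorem target_le : (Scaffold.target (T0 k m (3 * m)) (T1 k m (P1 k m))).size + 3 ≤ 4600 * SS k m ^ 2 := by
  obtain ⟨h0, h1⟩ := T_le (k := k) (m := m)
  have g0 := size_bigAnd_le (size_T_le (k := k) (m := m)).1; have g1 := size_bigAnd_le (size_T_le (k := k) (m := m)).2
  have hS : 1 ≤ SS k m ^ 2 := Nat.one_le_pow _ _ (atoms_le k m).1
  simp only [Scaffold.target, size]; linarith

/-- **Every abbreviation is the definition of a gate of some occurrence** (so its body is small). [folklore] -/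
theorem size_E_le {e : ℕ × PropForm ℕ} (he : e ∈ E k m (3 * m) (P1 k m) (kap k m + 1)) : e.2.size + 4 ≤ 29 := by
  suffices h : e.2.size ≤ 25 by omega
  have cell : ∀ {b : ℕ} {o : Occ} {j : ℕ}, e ∈ domCell k b o j → e.2.size ≤ 25 := fun he => by
    rcases List.mem_append.1 he with he | he
    · rcases List.mem_append.1 he with he | he <;> exact Occ.size_of_mem_edefs he
    · exact Occ.size_of_mem_edefs he
  have dist : ∀ {b : ℕ} {B C : ℕ → Occ}, e ∈ distDefs k m (P1 k m) b B C → e.2.size ≤ 25 := fun he => by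
    rcases List.mem_append.1 he with he | he
    · rcases List.mem_append.1 he with he | he
      · obtain ⟨c, -, he⟩ := List.mem_flatMap.1 he
        rcases List.mem_append.1 he with he | he <;> exact Occ.size_of_mem_edefs he
      · obtain ⟨c, -, he⟩ := List.mem_flatMap.1 he
        rcases List.mem_append.1 he with he | he
        · rcases List.mem_append.1 he with he | he <;> exact Occ.size_of_mem_edefs he
        · exact Occ.size_of_mem_edefs he
    · obtain ⟨c, -, he⟩ := List.mem_flatMap.1 he
      rcases List.mem_append.1 he with he | he
      · rcases List.mem_append.1 he with he | he <;> exact Occ.size_of_mem_edefs he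
      · exact Occ.size_of_mem_edefs he
  rcases List.mem_append.1 he with he | he
  · rcases List.mem_append.1 he with he | he
    · rcases List.mem_append.1 he with he | he
      · rcases List.mem_append.1 he with he | he
        · rcases List.mem_append.1 he with he | he
          · rcases List.mem_append.1 he with he | he
            · obtain ⟨j, -, he⟩ := List.mem_flatMap.1 he; exact cell he
            · simp only [List.mem_append] at he
              rcases he with ((he | he) | he) | he <;> exact Occ.size_of_mem_edefs he
          · rcases List.mem_append.1 he with he | he
            · rcases List.mem_append.1 he with he | he
              · obtain ⟨j, -, he⟩ := List.mem_flatMap.1 he; exact Occ.size_of_mem_edefs he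
              · obtain ⟨j, -, he⟩ := List.mem_flatMap.1 he; exact Occ.size_of_mem_edefs he
            · obtain ⟨j, -, he⟩ := List.mem_flatMap.1 he; exact Occ.size_of_mem_edefs he
        · obtain ⟨c, -, he⟩ := List.mem_flatMap.1 he
          obtain ⟨j, -, he⟩ := List.mem_flatMap.1 he; exact cell he
      · obtain ⟨j, -, he⟩ := List.mem_flatMap.1 he
        rcases List.mem_append.1 he with he | he <;> exact Occ.size_of_mem_edefs he
    · exact dist he
  · exact dist he

/-- The number of abbreviations is `≤ 200 S³`. [folklore] -/
theorem length_E_le : (E k m (3 * m) (P1 k m) (kap k m + 1)).length ≤ 200 * SS k m ^ 3 := by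
  obtain ⟨h1, hW, -, hL, hLd, hLu, hLm, -, -, -, -, -, -, hW2⟩ := atoms_le k m
  have hLc := chainT_le k m
  have hc1 : c1 k ≤ 6 * SS k m := by unfold c1; omega
  have hc6 : 5 * k.T.length + c6 k ≤ 8 * SS k m := by unfold c6; omega
  have hcell : ∀ b o j, (domCell k b o j).length = c1 k := fun b o j => by simp [domCell, c1]; ring
  have hdist : ∀ b B C, (distDefs k m (P1 k m) b B C).length = (W + 1) * (W + 1) * (5 * k.T.length + c6 k) := fun b B C => by
    simp only [distDefs, List.length_append, List.length_flatMap, Occ.length_edefs, c6]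
    simp only [List.map_const', List.sum_replicate, List.length_range, smul_eq_mul]; ring
  simp only [E, List.length_append, List.length_flatMap, Occ.length_edefs, hcell, hdist]
  simp only [List.map_const', List.sum_replicate, List.length_range, smul_eq_mul]
  have hW1 : W + 1 ≤ SS k m := by omega
  have e1 : (W + 1) * c1 k ≤ 6 * SS k m ^ 2 := (Nat.mul_le_mul hW1 hc1).trans_eq (by ring)
  have e2 : (2 * W + 3) * ((W + 1) * c1 k) ≤ 18 * SS k m ^ 3 := (Nat.mul_le_mul (show 2 * W + 3 ≤ 3 * SS k m by omega) e1).trans_eq (by ring)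
  have e3 : (W + 1) * (k.unitA.T.length + k.unitA.T.length) ≤ 2 * SS k m ^ 2 := (Nat.mul_le_mul hW1 (show _ ≤ 2 * SS k m by omega)).trans_eq (by ring)
  have e4 : (W + 1) * (W + 1) * (5 * k.T.length + c6 k) ≤ 8 * SS k m ^ 3 := (Nat.mul_le_mul (Nat.mul_le_mul hW1 hW1) hc6).trans_eq (by ring)
  have e5 : (W + 1) * k.chainT.length ≤ 8 * SS k m ^ 3 := (Nat.mul_le_mul hW1 hLc).trans_eq (by ring)
  have p3 : SS k m ^ 2 ≤ SS k m ^ 3 := Nat.pow_le_pow_right h1 (by norm_num)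
  linarith

/-- The scaffold part is `≤ 800000 S⁴`. [folklore] -/
theorem sizeBound_le : Scaffold.sizeBound (T0 k m (3 * m)) (T1 k m (P1 k m)) (E k m (3 * m) (P1 k m) (kap k m + 1)) ≤ 800000 * SS k m ^ 4 := by
  have h1 := (atoms_le k m).1
  obtain ⟨hT0, hT1⟩ := T_le (k := k) (m := m)
  have hT := target_le (k := k) (m := m)
  have hE := length_E_le (k := k) (m := m)
  have sumE : ((E k m (3 * m) (P1 k m) (kap k m + 1)).map fun e => e.2.size + 4).sum ≤ 29 * (200 * SS k m ^ 3) := by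
    have h := List.sum_le_card_nsmul ((E k m (3 * m) (P1 k m) (kap k m + 1)).map fun e => e.2.size + 4) 29 fun x hx => by
      obtain ⟨e, he, rfl⟩ := List.mem_map.1 hx; exact size_E_le he
    rw [List.length_map, smul_eq_mul] at h
    exact h.trans (by rw [Nat.mul_comm]; exact Nat.mul_le_mul_left _ hE)
  unfold Scaffold.sizeBound
  have e1 : 2 * ((T0 k m (3 * m)).length + (T1 k m (P1 k m)).length) + 7 ≤ 155 * SS k m ^ 2 := by
    have : 1 ≤ SS k m ^ 2 := Nat.one_le_pow _ _ h1; linarith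
  have e2 : (2 * ((T0 k m (3 * m)).length + (T1 k m (P1 k m)).length) + 7) * ((Scaffold.target (T0 k m (3 * m)) (T1 k m (P1 k m))).size + 3) ≤ 713000 * SS k m ^ 4 :=
    (Nat.mul_le_mul e1 hT).trans_eq (by ring)
  have p4 : SS k m ^ 3 ≤ SS k m ^ 4 := Nat.pow_le_pow_right h1 (by norm_num)
  linarith

/-- The step sizes of the laws are `O(S²)`. [folklore] -/
theorem steps_le : k.domStep W 1 ≤ 254 * SS k m ^ 2 ∧ k.unitStep W 1 ≤ 59 * SS k m ^ 2 ∧ k.distStep W 1 ≤ 631 * SS k m ^ 2 := by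
  obtain ⟨h1, hW, -, hL, -, -, -, hd1, hd2, hu1, hu2, hm1, hm2, hW2⟩ := atoms_le k m
  have t2 : ∀ {a b : ℕ}, a ≤ SS k m → b ≤ SS k m → a * (1 + b) ≤ 2 * SS k m ^ 2 := fun {a b} ha hb =>
    (Nat.mul_le_mul ha (show 1 + b ≤ 2 * SS k m by omega)).trans_eq (by ring)
  have pd := t2 hd1 hd2; have pu := t2 hu1 hu2; have pm := t2 hm1 hm2
  have p2 : SS k m ≤ SS k m ^ 2 := by nlinarith
  have q1 : (6 * W + 4) * (1 + 24) = 150 * W + 100 := by ring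
  have q2 : (5 * W) * (1 + 10) = 55 * W := by ring
  have q3 : (3 * k.T.length + 16 * W + 12) * (1 + 24) = 75 * k.T.length + 400 * W + 300 := by ring
  refine ⟨?_, ?_, ?_⟩
  · unfold OpKit.domStep; rw [q1]; linarith
  · unfold OpKit.unitStep; rw [q2]; linarith
  · unfold OpKit.distStep; rw [q3]; linarith

/-- The swap sizes are `O(S³)`. [folklore] -/
theorem swap_le : k.swapStep W 1 ≤ 2700 * SS k m ^ 3 ∧ k.swapBase W 1 ≤ 500 * SS k m ^ 3 := by
  obtain ⟨h1, hW, -, hL, -, -, -, -, -, -, -, -, -, hW2⟩ := atoms_le k m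
  have hLc := chainT_le k m
  obtain ⟨sDom, sUnit, sDist⟩ := steps_le (k := k) (m := m)
  have p2 : SS k m ≤ SS k m ^ 2 := by nlinarith
  have p3 : SS k m ^ 2 ≤ SS k m ^ 3 := Nat.pow_le_pow_right h1 (by norm_num)
  have hW1 : W + 1 ≤ SS k m := by omega
  constructor
  · unfold OpKit.swapStep
    have e1 : (W + 1) * k.distStep W 1 ≤ 631 * SS k m ^ 3 := (Nat.mul_le_mul hW1 sDist).trans_eq (by ring)
    have q4 : (3 * k.chainT.length + 2 * k.T.length + 20 * W + 8) * (1 + 24) = 75 * k.chainT.length + 50 * k.T.length + 500 * W + 200 := by ring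
    rw [q4]; linarith
  · unfold OpKit.swapBase
    have e1 : (W + 1) * k.domStep W 1 ≤ 254 * SS k m ^ 3 := (Nat.mul_le_mul hW1 sDom).trans_eq (by ring)
    have e2 : (W + 1) * k.unitStep W 1 ≤ 59 * SS k m ^ 3 := (Nat.mul_le_mul hW1 sUnit).trans_eq (by ring)
    have q4 : (k.chainT.length + 8 * W) * (1 + 10) = 11 * k.chainT.length + 88 * W := by ring
    rw [q4]; linarith

/-- The refutation is `≤ 7500 S⁴`. [folklore] -/
theorem refSize_le : refSize k m 1 ≤ 7500 * SS k m ^ 4 := by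
  obtain ⟨h1, hW, hm, hL, -, -, -, -, -, -, -, -, -, hW2⟩ := atoms_le k m
  have hLc := chainT_le k m
  obtain ⟨sDom, -, -⟩ := steps_le (k := k) (m := m)
  obtain ⟨sStep, sBase⟩ := swap_le (k := k) (m := m)
  have p2 : SS k m ≤ SS k m ^ 2 := by nlinarith
  have p3 : SS k m ^ 2 ≤ SS k m ^ 3 := Nat.pow_le_pow_right h1 (by norm_num)
  have p4 : SS k m ^ 3 ≤ SS k m ^ 4 := Nat.pow_le_pow_right h1 (by norm_num)
  have p0 : 1 ≤ SS k m ^ 2 := Nat.one_le_pow _ _ h1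
  have s0 : size0 k m 1 ≤ 1800 * SS k m ^ 2 := by
    unfold size0; rw [length_compDefs]
    have hm' : m - 1 + 1 ≤ SS k m := by omega
    have q : (1 + k.T.length + 3 * k.chainT.length + W + 1) * (1 + 57 + 1) = 59 * (1 + k.T.length + 3 * k.chainT.length + W + 1) := by ring
    rw [q]; linarith
  have s1 : size1 k m 1 ≤ 300 * SS k m ^ 2 := by
    unfold size1
    have q : (3 * m + 4 * W + k.T.length + 2 * k.chainT.length) * (1 + 10) = 11 * (3 * m + 4 * W + k.T.length + 2 * k.chainT.length) := by ring
    rw [q]; linarith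
  have s2 : size2 k 1 ≤ 1300 * SS k m ^ 4 := by
    unfold size2
    have e1 : (W + 1) * k.domStep W 1 ≤ 254 * SS k m ^ 3 := (Nat.mul_le_mul (show W + 1 ≤ SS k m by omega) sDom).trans_eq (by ring)
    have e2 : (2 * W + 5) * ((W + 1) * k.domStep W 1) ≤ 1270 * SS k m ^ 4 := (Nat.mul_le_mul (show 2 * W + 5 ≤ 5 * SS k m by omega) e1).trans_eq (by ring)
    linarith
  have s3 : size3 k 1 ≤ 3800 * SS k m ^ 4 := by
    unfold size3
    have e1 : W * k.swapStep W 1 ≤ 2700 * SS k m ^ 4 := (Nat.mul_le_mul hW sStep).trans_eq (by ring)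
    have q1 : (k.chainT.length + 5 * W) * (1 + 10) = 11 * (k.chainT.length + 5 * W) := by ring
    have q2 : 3 * ((k.chainT.length + 2 * W) * (1 + 10)) = 33 * (k.chainT.length + 2 * W) := by ring
    have q3 : 6 * (W * (1 + 10)) = 66 * W := by ring
    rw [q1, q2, q3]; linarith
  unfold refSize; linarith

/-- **The total size of the construction at bit length `m` is `≤ 10⁶ · S⁴`.** [folklore] -/
theorem total_le : Scaffold.sizeBound (T0 k m (3 * m)) (T1 k m (P1 k m)) (E k m (3 * m) (P1 k m) (kap k m + 1)) + refSize k m 1 + 3 ≤ 1000000 * SS k m ^ 4 := by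
  have h1 := (atoms_le k m).1
  have hB := sizeBound_le (k := k) (m := m); have hR := refSize_le (k := k) (m := m)
  have : 3 ≤ 3 * SS k m ^ 4 := Nat.le_mul_of_pos_right _ (Nat.pow_pos h1)
  linarith

end Size

/-! ### Kit families and the theorem -/

/-- A **kit family**: for every bit length `m` an operation kit on `W_m ≥ max m 1` bit words
computing modular multiplication (for first operands below the modulus `n`, `0 < n < 2^m`)
with unit pattern `1`, a common finite rule list, and polynomial size. [folklore] -/
structure KitFamily where
  /-- the word width at bit length `m` -/
  Wd : ℕ → ℕ
  /-- the kit at bit length `m` -/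
  kit : ∀ m, ModAdd.OpKit (Wd m)
  /-- the words accommodate `m` bits -/
  hmW : ∀ m, m ≤ Wd m
  /-- the words are nonempty -/
  hW : ∀ m, 0 < Wd m
  /-- the high bits of the modulus start at `m` -/
  hkm : ∀ m, m ≤ (kit m).m
  /-- the admissible moduli of the kit at bit length `m` -/
  NOK : ℕ → ℕ → Prop
  /-- the kit computes modular multiplication -/
  computes : ∀ m, (kit m).Computes (NOK m) fun x y N => x * y % N
  /-- every modulus `0 < n < 2^m` is admissible -/
  hNOK : ∀ m n, 0 < n → n < 2 ^ m → NOK m n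
  /-- the unit pattern is `1` -/
  he1 : ∀ m, ∀ i < Wd m, (kit m).e i = decide (i = 0)
  /-- the common rule list -/
  ruleList : List FregeRule
  /-- the kits use the common rule list -/
  rules_eq : ∀ m, (kit m).ruleList = ruleList
  /-- polynomial size -/
  poly : ∃ c d : ℕ, ∀ m, KS (kit m) ≤ c * (m + 1) ^ d

/-- Sums of polynomially bounded quantities. [folklore] -/
theorem KS_add_le {c d m x : ℕ} (hx : x ≤ c * (m + 1) ^ d) : x + m + 2 ≤ (c + 2) * (m + 1) ^ (d + 1) := by
  have h1 : 1 ≤ (m + 1) ^ d := Nat.one_le_pow _ _ (Nat.succ_pos m)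
  have h2 : (m + 1) ^ d ≤ (m + 1) ^ (d + 1) := Nat.pow_le_pow_right (Nat.succ_pos m) (Nat.le_succ d)
  have h3 : m + 1 ≤ (m + 1) ^ (d + 1) := by
    calc m + 1 = (m + 1) ^ 1 := (pow_one _).symm
      _ ≤ (m + 1) ^ (d + 1) := Nat.pow_le_pow_right (Nat.succ_pos m) (by omega)
  have h4 : c * (m + 1) ^ d ≤ c * (m + 1) ^ (d + 1) := Nat.mul_le_mul_left _ h2
  nlinarith

/-- The variables of `T₀` and `T₁` meet only in the atoms. [folklore] -/
theorem vars_inter (hW : 0 < W) : (bigAnd (T0 k m (3 * m))).vars ∩ (neg (bigAnd (T1 k m (P1 k m)))).vars ⊆ Finset.range (3 * m) := by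
  intro x hx
  rw [Finset.mem_inter] at hx
  obtain ⟨h0, h1⟩ := hx
  rw [vars] at h1
  obtain ⟨c0, hc0, hx0⟩ := mem_vars_bigAnd.1 h0
  obtain ⟨c1, hc1, hx1⟩ := mem_vars_bigAnd.1 h1
  rw [Finset.mem_range]
  rcases inCopy_T0 k m le_rfl hW hc0 hx0 with h | ⟨-, h⟩
  · exact h
  · rcases inCopy_T1 k m (le_bEnd _) hW hc1 hx1 with h' | ⟨h', -⟩
    · exact h'
    · exact absurd h (not_lt.2 h')

open Polynomial in
/-- **`RSAPairDisjointnessEFProofs` from a kit family** (Krajíček–Pudlák 1998, Thm. 1 / Cor. 10,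
with the modular arithmetic inside `EF` supplied by the kits): the tautologies `¬⋀T₀ ∨ ¬⋀T₁`
have polynomial-size `EF`-proofs in every Frege system, and `⋀T_c` is satisfiable over every
member of `A^c` below `2^m`. [cite: KrajicekPudlak1998, Thm. 1, Cor. 10] -/
theorem rsaPairDisjointnessEFProofs_of_kitFamily (Φ : KitFamily) : Literature.Barriers.PneNP.RSAPairDisjointnessEFProofs := by
  intro F hF
  -- the common proof system of the construction and its translation into `F`
  set G₀ : FregeSystem := ⟨Scaffold.rules ++ allRulesC ++ Φ.ruleList ++ rules⟩ with hG₀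
  have hsys : ∀ m, sys (Φ.kit m) = G₀ := fun m => by simp only [sys, hG₀, Φ.rules_eq]
  have hsound : G₀.IsSound := by rw [← hsys 0]; exact isSound_sys _
  obtain ⟨B, hB⟩ := FregeSystem.exists_translationEF (F₁ := F) (F₂ := G₀) hF.2 hsound
  obtain ⟨c, d, hc⟩ := Φ.poly
  -- the size polynomial
  set A := 1000000 * (c + 2) ^ 4 with hA
  set D := 4 * (d + 1) with hD
  refine ⟨Polynomial.C ((B + 2) * A ^ 2) * (Polynomial.X + 1) ^ (2 * D), fun m => ?_⟩
  have hWm := Φ.hW m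
  obtain ⟨π, hπ, hsz⟩ := exists_proof (k := Φ.kit m) (m := m) hWm (Φ.hkm m)
  rw [hsys m] at hπ
  obtain ⟨π', hπ', hsz'⟩ := hB π _ hπ
  have hS : SS (Φ.kit m) m ≤ (c + 2) * (m + 1) ^ (d + 1) := KS_add_le (hc m)
  have hs : proofSize π ≤ A * (m + 1) ^ D := by
    refine (hsz.trans total_le).trans ?_
    calc 1000000 * SS (Φ.kit m) m ^ 4 ≤ 1000000 * ((c + 2) * (m + 1) ^ (d + 1)) ^ 4 := Nat.mul_le_mul_left _ (Nat.pow_le_pow_left hS 4)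
      _ = A * (m + 1) ^ D := by rw [hA, hD]; ring
  refine ⟨bigAnd (T0 (Φ.kit m) m (3 * m)), neg (bigAnd (T1 (Φ.kit m) m (P1 (Φ.kit m) m))), π', vars_inter hWm, hπ', ?_, fun n e y hn he hy hmem => ?_,
    fun n e y hn he hy hmem => ?_⟩
  · -- size
    simp only [Polynomial.eval_mul, Polynomial.eval_C, Polynomial.eval_pow, Polynomial.eval_add, Polynomial.eval_X, Polynomial.eval_one]
    have h2 : proofSize π * (B * proofSize π + proofSize π) + proofSize π ≤ (B + 2) * (proofSize π * proofSize π) := by nlinarith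
    have h3 : proofSize π * proofSize π ≤ (A * (m + 1) ^ D) * (A * (m + 1) ^ D) := Nat.mul_le_mul hs hs
    calc proofSize π' ≤ (B + 2) * (proofSize π * proofSize π) := hsz'.trans h2
      _ ≤ (B + 2) * ((A * (m + 1) ^ D) * (A * (m + 1) ^ D)) := Nat.mul_le_mul_left _ h3
      _ = (B + 2) * A ^ 2 * (m + 1) ^ (2 * D) := by ring
  · -- covering for `A⁰`
    obtain ⟨σ, hσ, hT⟩ := sem_T0 (k := Φ.kit m) (P := 3 * m) (Φ.computes m) (Φ.hNOK m) (Φ.he1 m) (Φ.hmW m) le_rfl hmem hn he hy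
    exact ⟨σ, hσ, eval_bigAnd_eq_true.2 hT⟩
  · -- covering for `A¹`
    obtain ⟨σ, hσ, hT⟩ := sem_T1 (k := Φ.kit m) (P := P1 (Φ.kit m) m) (Φ.computes m) (Φ.hNOK m) (Φ.he1 m) (Φ.hmW m) (le_bEnd _) hmem hn he hy
    exact ⟨σ, hσ, by simp only [PropForm.eval, eval_bigAnd_eq_true.2 hT, Bool.not_true]⟩

end RSA

end Literature.Computability.MetaComplexity
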